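import Literature.Analysis.FluidPDE.KochTataruFourierSlice
import Literature.Analysis.FluidPDE.KochTataruDuhamelFourier
import Literature.Analysis.FluidPDE.KochTataruCarleson
import HarnessLib

/-!
# Koch–Tataru's near-field `L²` estimate (13) for nice data: Plancherel, the symbol, and the energy identity assembled

Analysis/FluidPDE proof companion of `Literature/Analysis/FluidPDE/KochTataru.lean` and
`KochTataruCarleson.lean`. The one named fact left in the bilinear estimate (L1)
`kochTataruBilinear_estimate` (Koch–Tataru, Adv. Math. 157 (2001), Lemmas 3.1–3.2) is the near-part
`L²` estimate `kochTataruBilinear_nearCarleson`, Koch–Tataru's (13):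
`‖V∇Πf‖_{L²(Q(0,1))} ≤ c‖f‖_{Y₁}` for `f` supported in the doubled cylinder, proved in the paper on
the Fourier side in `x` (Step 3: "`Π` … is a bounded operator in `L²` and commutes with `∇V`";
Step 4: the energy computation (16)–(17) for `v(t) = ∇S(t)∫₀ᵗ w`; Step 5 / Remark 3.3: the
averaging bound (18)–(20) and the energy inequality (21)). This file **assembles that proof for the
tree's explicit operator `B(u, v) = kochTataruBilinear u v` and proves (13) for nice data**
(`exists_lintegral_sq_kochTataruBilinear_le_of_nice`): there is `C = C(E)` such that for all pairs
`u`, `v` jointly strongly measurable with finite Koch–Tataru norms, `‖u‖ ‖v‖` bounded and `u`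
supported in `ℝ × B(x₀, ρ)`, and `0 < T ≤ ρ²`,

  `∫₀ᵀ ∫_E ‖B(u, v)(t, x)‖² dx dt ≤ C ρ^d ‖u‖_X² ‖v‖_X²`.

The boundedness/support hypotheses only serve the absolute convergence of the Fourier-side
integrals (the paper's "we will not be precise about the domain of operators"); the general case
of `kochTataruBilinear_nearCarleson` follows by spatial cut-off (already in its statement) and
truncation in time with Fatou (next file). The chain of (in)equalities, each a theorem below:

1. `lintegral_enorm_sq_kochTataruBilinear_slice_le` (**Plancherel per slice and the symbol**,
   Step 3): with the components `(u ⊗ v)_{mk} = ⟪u, bₘ⟫⟪v, bₖ⟫` (`tensorComp`) in an orthonormal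
   frame `b`, their `x`-Fourier coefficients `(u ⊗ v)^_{mk}(s, ξ)` (`tensorCoeff`) and damped primitives
   `Y_{mk}(t, ξ) = ∫₀ᵗ e^{-(2π)²|ξ|²(t-s)} (u ⊗ v)^_{mk}(s, ξ) ds` (`dampedCoeff`), the slice
   `B(u,v)(t)` is in `L¹ ∩ L²` with `𝓕⟪B(u,v)(t), bⱼ⟫ = ∑ₘₖ 2πi⟪ξ,bₘ⟫⟪P(ξ)bₖ,bⱼ⟫ Y_{mk}(t,ξ)`
   (`fourier_inner_kochTataruBilinear_eq_sum`, from `KochTataruFourierSlice`), so that by Plancherel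
   (`PlancherelL1L2`) and the `ℓ²` bound on the symbol (`KochTataruSymbol`)
   `∫ ‖B(u,v)(t,x)‖² dx ≤ ∫ (2π)²|ξ|² ∑ₘₖ |Y_{mk}(t,ξ)|² dξ` (in `ℝ≥0∞`: the right side need not be
   finite pointwise-integrable);
2. `lintegral_lintegral_enorm_sq_kochTataruBilinear_le_sum` (**Tonelli in `(t, ξ)` and (21) mode by
   mode**, `energyIneq_dampedCoeff` = `KochTataruEnergy.mul_setIntegral_norm_sq_duhamelExp_le` with
   `a = (2π)²|ξ|²`): `∫₀ᵀ‖B‖²_{L²} ≤ ∑ₘₖ ∫ Re ∫₀ᵀ conj(Y_{mk}) (u ⊗ v)^_{mk} dt dξ`;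
3. `lintegral_ofReal_re_setIntegral_le` (**Fubini back and Parseval per slice**): the integrand
   `conj(Y)(u ⊗ v)^` is integrable on `(0,T) × E_ξ` (`integrable_conj_dampedCoeff_mul_tensorCoeff`:
   Cauchy–Schwarz in `ξ` and Plancherel twice, the heat potential `V(u ⊗ v)_{mk}`
   (`heatPotentialComp`) being in `L¹ ∩ L² ∩ L^∞` with `𝓕 V(u ⊗ v)_{mk}(t) = Y_{mk}(t)`
   (`fourier_heatPotentialComp`, from `KochTataruFourierSlice.fourier_heatPotential_slice`)), and
   `Re ∫ conj(Y(t)) (u ⊗ v)^(t) dξ = ∫ V(u ⊗ v)(t) (u ⊗ v)(t) dx ≤ ‖V(u ⊗ v)‖_∞ ‖(u ⊗ v)(t)‖₁`;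
4. the heat-potential bound (20) (`KochTataruEnergy.exists_setLIntegral_heatKernel_mul_le`:
   `‖V(u ⊗ v)‖_∞ ≤ C ‖u‖_X ‖v‖_X`) and Lemma 3.1 on the doubled box
   (`setLIntegral_slab_mul_le_of_support`: `‖u ⊗ v‖_{L¹((0,T) × E)} ≤ ρ^d ‖u‖_X ‖v‖_X`).

## Mathlib / tree search

Tree: `fourier_inner_kochTataruBilinear_slice`, `fourier_heatPotential_slice`,
`integrable_kochTataruBilinear_slice` (`KochTataruFourierSlice`); `sum_norm_sq_sum_oseenSymbol_mul_le`,
`re_integral_conj_fourier_mul_eq`, `memLp_two_of_integrable_of_bound` (`KochTataruSymbol`);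
`mul_setIntegral_norm_sq_duhamelExp_le`, `exists_setLIntegral_heatKernel_mul_le` (`KochTataruEnergy`),
`heatSymbol_sub_eq_exp` (`KochTataruDuhamelFourier`); `setLIntegral_box_mul_le`,
`exists_enorm_kochTataruBilinear_le`, `setLIntegral_Ioo_rpow_neg_half` (`KochTataruPointwise`);
`FunctionSpaces.lintegral_enorm_sq_fourierIntegral_eq`, `continuous_fourierIntegral`
(`PlancherelL1L2`); `measurable_heatKernel_uncurry`, `lintegral_enorm_heatKernel`,
`heatSymbol_pos/le_one`. `KochTataruDuhamelFourier.lean` proves the scalar-source versions of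
steps 2–3 in iterated form; here the product-measure (`(0,t) × E`) form of `kochTataruBilinear` and of
`KochTataruFourierSlice` is kept throughout, so the objects are not interchangeable verbatim and the
overlap is confined to the elementary slice bounds. Mathlib: `OrthonormalBasis.sum_inner_mul_inner`,
`sum_repr'`, `sum_sq_inner_left`, `StronglyMeasurable.integral_prod_right'`,
`Measurable.lintegral_prod_left'`, `lintegral_lintegral_swap`, `lintegral_finsetSum(')`,
`integral_finsetSum`, `integral_integral_swap`, `Integrable.integral_prod_left/right`,
`Integrable.integral_norm_prod_left`, `ENNReal.lintegral_mul_le_Lp_mul_Lq`,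
`Measure.integrableOn_of_bounded`, `Integrable.bdd_mul`, `Integrable.mul_prod`, `integral_prod_mul`,
`ofReal_integral_eq_lintegral_ofReal`, `integral_re`, `norm_setIntegral_le_of_norm_le_const`.

## References

* H. Koch, D. Tataru, *Well-posedness for the Navier–Stokes equations*, Adv. Math. 157 (2001)
  22–35, §3: Lemma 3.1, Lemma 3.2 (Step 1, (13); Step 3, (15); Step 4, (16)–(17); Step 5,
  (18)–(19)), Remark 3.3 ((20), (21)). Bib key `KochTataruAdvMath2001` (held:
  doi:10.1006/aima.2000.1937, pp. 6–9 of the preprint).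
-/

noncomputable section

open MeasureTheory Set Function Filter Topology Metric Real
open scoped ENNReal NNReal RealInnerProductSpace FourierTransform ComplexConjugate

namespace Literature.Analysis.FluidPDE

open UnboundedOperators (heatKernel heatSymbol)

/-! ## The tensor components, their Fourier coefficients, damped primitives and heat potentials -/

section Objects

variable {E : Type*} [NormedAddCommGroup E] [InnerProductSpace ℝ E] [FiniteDimensional ℝ E]
  [MeasurableSpace E] [BorelSpace E] {ι : Type*} [Fintype ι]

/-- The **scalar components of the tensor `u ⊗ v`** in an orthonormal frame `b`:
`(u ⊗ v)_{mk}(s, y) = ⟪u(s,y), bₘ⟫ ⟪v(s,y), bₖ⟫` (Koch–Tataru 2001, (11): `N(u) = u ⊗ u`; the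
bilinear estimate is proved entry by entry). A proof device for the near-field estimate. [cite: KochTataruAdvMath2001, §3 (11)] -/
def tensorComp (b : OrthonormalBasis ι ℝ E) (u v : ℝ → E → E) (m k : ι) : ℝ × E → ℝ :=
  fun p => ⟪u p.1 p.2, b m⟫ * ⟪v p.1 p.2, b k⟫

/-- The **`x`-Fourier coefficients of the tensor components**, `(u ⊗ v)^_{mk}(s, ξ) = 𝓕_y (u ⊗ v)_{mk}(s, ·)(ξ)`
(Koch–Tataru 2001, Steps 3–4: the `L²` estimate is computed on the Fourier side in `x`). [cite: KochTataruAdvMath2001, Lemma 3.2 Steps 3–4] -/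
def tensorCoeff (b : OrthonormalBasis ι ℝ E) (u v : ℝ → E → E) (m k : ι) (s : ℝ) (ξ : E) : ℂ :=
  𝓕 (fun y : E => ((tensorComp b u v m k (s, y) : ℝ) : ℂ)) ξ

/-- The **damped primitives of the Fourier coefficients**,
`Y_{mk}(t, ξ) = ∫₀ᵗ e^{-(2π)²|ξ|²(t-s)} (u ⊗ v)^_{mk}(s, ξ) ds`, i.e. the `x`-Fourier transform of the
heat potential `V(u ⊗ v)_{mk}(t)` (Koch–Tataru 2001, (16): `v(t) = ∇S(t)∫₀ᵗ w(s) ds` frequency by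
frequency). [cite: KochTataruAdvMath2001, Lemma 3.2 Step 4 (16)] -/
def dampedCoeff (b : OrthonormalBasis ι ℝ E) (u v : ℝ → E → E) (m k : ι) (t : ℝ) (ξ : E) : ℂ :=
  ∫ s in Ioo 0 t, (Real.exp (-((2 * π) ^ 2 * ‖ξ‖ ^ 2 * (t - s))) : ℂ) * tensorCoeff b u v m k s ξ

/-- The **heat potentials of the tensor components**,
`V(u ⊗ v)_{mk}(t, x) = ∫_{(0,t) × E} G_{t-s}(x - y) (u ⊗ v)_{mk}(s, y) d(s,y)` (Koch–Tataru 2001, §2: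
`Vf(t) = ∫₀ᵗ S(s)f(t-s) ds`; Remark 3.3). [cite: KochTataruAdvMath2001, §2 and Remark 3.3] -/
def heatPotentialComp (b : OrthonormalBasis ι ℝ E) (u v : ℝ → E → E) (m k : ι) (t : ℝ) (x : E) : ℝ :=
  ∫ p in Ioo 0 t ×ˢ univ, heatKernel (t - p.1) (x - p.2) * tensorComp b u v m k p
    ∂(volume : Measure (ℝ × E))

variable (b : OrthonormalBasis ι ℝ E) {u v : ℝ → E → E} {m k : ι}

omit [FiniteDimensional ℝ E] [MeasurableSpace E] [BorelSpace E] in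
/-- `|(u ⊗ v)_{mk}| ≤ ‖u‖ ‖v‖` pointwise. [folklore] -/
theorem abs_tensorComp_le (u v : ℝ → E → E) (m k : ι) (p : ℝ × E) :
    |tensorComp b u v m k p| ≤ ‖u p.1 p.2‖ * ‖v p.1 p.2‖ := by
  unfold tensorComp
  rw [abs_mul]
  refine mul_le_mul ?_ ?_ (abs_nonneg _) (norm_nonneg _)
  · simpa [b.orthonormal.1 m] using abs_real_inner_le_norm (u p.1 p.2) (b m)
  · simpa [b.orthonormal.1 k] using abs_real_inner_le_norm (v p.1 p.2) (b k)

/-- The tensor components of strongly measurable fields are measurable. [folklore] -/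
theorem measurable_tensorComp (hu : StronglyMeasurable (uncurry u)) (hv : StronglyMeasurable (uncurry v))
    (m k : ι) : Measurable (tensorComp b u v m k) := by
  unfold tensorComp
  exact (hu.measurable.inner measurable_const).mul (hv.measurable.inner measurable_const)

/-! ### Nice data: bounded tensor supported in a ball -/

omit [FiniteDimensional ℝ E] [MeasurableSpace E] [BorelSpace E] in
/-- For a tensor bounded by `M` with first factor supported in `B(x₀, ρ)`, the components are
bounded by `M` times the indicator of the ball. [folklore] -/
theorem abs_tensorComp_le_indicator {M : ℝ} (hM : ∀ s y, ‖u s y‖ * ‖v s y‖ ≤ M) {x₀ : E} {ρ : ℝ}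
    (hsupp : ∀ s y, y ∉ ball x₀ ρ → u s y = 0) (m k : ι) (p : ℝ × E) :
    |tensorComp b u v m k p| ≤ M * (ball x₀ ρ).indicator (fun _ => (1 : ℝ)) p.2 := by
  by_cases hp : p.2 ∈ ball x₀ ρ
  · rw [indicator_of_mem hp, mul_one]
    exact (abs_tensorComp_le b u v m k p).trans (hM p.1 p.2)
  · rw [indicator_of_notMem hp, mul_zero]
    unfold tensorComp
    rw [hsupp p.1 p.2 hp, inner_zero_left, zero_mul, abs_zero]

/-- The indicator bound of a nice tensor is integrable on `E`. [folklore] -/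
theorem integrable_ballIndicator (M : ℝ) (x₀ : E) (ρ : ℝ) :
    Integrable (fun y : E => M * (ball x₀ ρ).indicator (fun _ => (1 : ℝ)) y) :=
  ((integrableOn_const (measure_ball_lt_top).ne).integrable_indicator measurableSet_ball).const_mul M

/-- `∫ M 1_{B(x₀,ρ)} = M |B(x₀, ρ)|`. [folklore] -/
theorem integral_ballIndicator (M : ℝ) (x₀ : E) (ρ : ℝ) :
    ∫ y : E, M * (ball x₀ ρ).indicator (fun _ => (1 : ℝ)) y = M * (volume (ball x₀ ρ)).toReal := by
  rw [integral_const_mul, integral_indicator measurableSet_ball, setIntegral_const, smul_eq_mul,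
    mul_one, measureReal_def]

/-- **Slices of the components of a nice tensor are integrable**, with
`∫ |(u ⊗ v)_{mk}(s, y)| dy ≤ M |B(x₀, ρ)|` and `∫ |(u ⊗ v)_{mk}(s, y)|² dy ≤ M² |B(x₀, ρ)|`. [folklore] -/
theorem integrable_tensorComp_slice (hu : StronglyMeasurable (uncurry u))
    (hv : StronglyMeasurable (uncurry v)) {M : ℝ} (hM : ∀ s y, ‖u s y‖ * ‖v s y‖ ≤ M) {x₀ : E} {ρ : ℝ}
    (hsupp : ∀ s y, y ∉ ball x₀ ρ → u s y = 0) (m k : ι) (s : ℝ) :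
    Integrable (fun y => tensorComp b u v m k (s, y)) ∧
      (∫ y, |tensorComp b u v m k (s, y)| ≤ M * (volume (ball x₀ ρ)).toReal) ∧
      Integrable (fun y => tensorComp b u v m k (s, y) ^ 2) ∧
      (∫ y, tensorComp b u v m k (s, y) ^ 2 ≤ M ^ 2 * (volume (ball x₀ ρ)).toReal) := by
  have hM0 : 0 ≤ M := (mul_nonneg (norm_nonneg _) (norm_nonneg _)).trans (hM s x₀)
  have hmeas : Measurable fun y => tensorComp b u v m k (s, y) :=
    (measurable_tensorComp b hu hv m k).comp (measurable_const.prodMk measurable_id)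
  have hpt : ∀ y, |tensorComp b u v m k (s, y)| ≤ M * (ball x₀ ρ).indicator (fun _ => (1 : ℝ)) y :=
    fun y => abs_tensorComp_le_indicator b hM hsupp m k (s, y)
  have hpt2 : ∀ y, tensorComp b u v m k (s, y) ^ 2 ≤ M ^ 2 * (ball x₀ ρ).indicator (fun _ => (1 : ℝ)) y := by
    intro y
    have h := hpt y
    by_cases hy : y ∈ ball x₀ ρ
    · rw [indicator_of_mem hy, mul_one] at h ⊢
      calc tensorComp b u v m k (s, y) ^ 2 = |tensorComp b u v m k (s, y)| ^ 2 := (sq_abs _).symm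
        _ ≤ M ^ 2 := pow_le_pow_left₀ (abs_nonneg _) h 2
    · rw [indicator_of_notMem hy, mul_zero] at h ⊢
      have h0 : tensorComp b u v m k (s, y) = 0 := abs_nonpos_iff.1 h
      rw [h0]; norm_num
  have hint1 : Integrable (fun y => tensorComp b u v m k (s, y)) :=
    (integrable_ballIndicator M x₀ ρ).mono' hmeas.aestronglyMeasurable
      (Eventually.of_forall fun y => by rw [Real.norm_eq_abs]; exact hpt y)
  have hint2 : Integrable (fun y => tensorComp b u v m k (s, y) ^ 2) :=
    (integrable_ballIndicator (M ^ 2) x₀ ρ).mono' (hmeas.pow_const 2).aestronglyMeasurable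
      (Eventually.of_forall fun y => by
        rw [Real.norm_eq_abs, abs_of_nonneg (sq_nonneg _)]; exact hpt2 y)
  refine ⟨hint1, ?_, hint2, ?_⟩
  · rw [← integral_ballIndicator M x₀ ρ]
    exact integral_mono hint1.abs (integrable_ballIndicator M x₀ ρ) hpt
  · rw [← integral_ballIndicator (M ^ 2) x₀ ρ]
    exact integral_mono hint2 (integrable_ballIndicator (M ^ 2) x₀ ρ) hpt2

/-- The indicator bound is integrable on every slab `(0, t) × E`, with integral `t M |B(x₀,ρ)|`
(`t ≥ 0`). [folklore] -/
theorem integrable_ballIndicator_slab (M : ℝ) (x₀ : E) (ρ : ℝ) {t : ℝ} (ht : 0 ≤ t) :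
    Integrable (fun p : ℝ × E => M * (ball x₀ ρ).indicator (fun _ => (1 : ℝ)) p.2)
        ((volume : Measure (ℝ × E)).restrict (Ioo 0 t ×ˢ univ)) ∧
      ∫ p in Ioo 0 t ×ˢ univ, M * (ball x₀ ρ).indicator (fun _ => (1 : ℝ)) p.2
        ∂(volume : Measure (ℝ × E)) = t * (M * (volume (ball x₀ ρ)).toReal) := by
  rw [FluidPDE.volume_restrict_prod_univ_eq_prod]
  have hfin : IsFiniteMeasure ((volume : Measure ℝ).restrict (Ioo 0 t)) :=
    ⟨by rw [Measure.restrict_apply_univ]; exact measure_Ioo_lt_top⟩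
  have h1 : Integrable (fun _ : ℝ => (1 : ℝ)) ((volume : Measure ℝ).restrict (Ioo 0 t)) :=
    integrable_const 1
  have h := h1.mul_prod (integrable_ballIndicator M x₀ ρ (E := E))
  simp only [one_mul] at h
  refine ⟨h, ?_⟩
  have hp := integral_prod_mul (μ := (volume : Measure ℝ).restrict (Ioo 0 t)) (ν := (volume : Measure E))
    (fun _ : ℝ => (1 : ℝ)) (fun y : E => M * (ball x₀ ρ).indicator (fun _ => (1 : ℝ)) y)
  simp only [one_mul] at hp
  rw [hp, integral_ballIndicator, setIntegral_const, smul_eq_mul, mul_one,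
    Real.volume_real_Ioo_of_le ht, sub_zero]

/-- **The components of a nice tensor are integrable on every slab `(0, t) × E`**, with
`∫_{(0,t) × E} |(u ⊗ v)_{mk}| ≤ t M |B(x₀, ρ)|` (`t ≥ 0`). [folklore] -/
theorem integrable_tensorComp_slab (hu : StronglyMeasurable (uncurry u))
    (hv : StronglyMeasurable (uncurry v)) {M : ℝ} (hM : ∀ s y, ‖u s y‖ * ‖v s y‖ ≤ M) {x₀ : E} {ρ : ℝ}
    (hsupp : ∀ s y, y ∉ ball x₀ ρ → u s y = 0) (m k : ι) {t : ℝ} (ht : 0 ≤ t) :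
    Integrable (tensorComp b u v m k) ((volume : Measure (ℝ × E)).restrict (Ioo 0 t ×ˢ univ)) ∧
      ∫ p in Ioo 0 t ×ˢ univ, |tensorComp b u v m k p| ∂(volume : Measure (ℝ × E)) ≤
        t * (M * (volume (ball x₀ ρ)).toReal) := by
  obtain ⟨hbi, hbint⟩ := integrable_ballIndicator_slab M x₀ ρ ht (E := E)
  have hmeas : Measurable (tensorComp b u v m k) := measurable_tensorComp b hu hv m k
  have hpt : ∀ p : ℝ × E, |tensorComp b u v m k p| ≤ M * (ball x₀ ρ).indicator (fun _ => (1 : ℝ)) p.2 :=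
    fun p => abs_tensorComp_le_indicator b hM hsupp m k p
  have hint : Integrable (tensorComp b u v m k) ((volume : Measure (ℝ × E)).restrict (Ioo 0 t ×ˢ univ)) :=
    hbi.mono' hmeas.aestronglyMeasurable (Eventually.of_forall fun p => by
      rw [Real.norm_eq_abs]; exact hpt p)
  refine ⟨hint, ?_⟩
  rw [← hbint]
  exact integral_mono hint.abs hbi hpt

omit [InnerProductSpace ℝ E] [FiniteDimensional ℝ E] [MeasurableSpace E] [BorelSpace E] [Fintype ι] in
/-- `∫₀ᵗ (t - s)^{-1/2} ds = 2√t` as a set `∫⁻` (`t > 0`). [folklore] -/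
theorem setLIntegral_Ioo_sub_rpow_neg_half' {t : ℝ} (ht : 0 < t) :
    ∫⁻ s in Ioo 0 t, ENNReal.ofReal ((t - s) ^ (-(1 / 2 : ℝ))) = ENNReal.ofReal (2 * Real.sqrt t) := by
  have hmp : MeasurePreserving (fun s : ℝ => t - s) volume volume :=
    Measure.measurePreserving_sub_left volume t
  have hemb : MeasurableEmbedding (fun s : ℝ => t - s) :=
    (MeasurableEquiv.subLeft t).measurableEmbedding
  have h := hmp.setLIntegral_comp_preimage_emb hemb
    (fun σ => ENNReal.ofReal (σ ^ (-(1 / 2 : ℝ)))) (Ioo 0 t)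
  rw [preimage_const_sub_Ioo, sub_zero, sub_self] at h
  rw [h, setLIntegral_Ioo_rpow_neg_half ht]

/-- **Nice tensors satisfy the `L¹`-majorant condition** of `KochTataruFourierSlice.lean`:
`∫_{(0,t) × E} (t-s)^{-1/2} ‖u‖ ‖v‖ ≤ 2√t M |B(x₀, ρ)| < ∞`. [folklore] -/
theorem lintegral_majorant_lt_top {M : ℝ} (hM : ∀ s y, ‖u s y‖ * ‖v s y‖ ≤ M) {x₀ : E} {ρ : ℝ}
    (hsupp : ∀ s y, y ∉ ball x₀ ρ → u s y = 0) {t : ℝ} (ht : 0 < t) :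
    ∫⁻ p in Ioo 0 t ×ˢ univ, ENNReal.ofReal ((t - p.1) ^ (-(1 / 2 : ℝ))) *
      (‖u p.1 p.2‖ₑ * ‖v p.1 p.2‖ₑ) ∂(volume : Measure (ℝ × E)) < ∞ := by
  have hpt : ∀ p : ℝ × E, ‖u p.1 p.2‖ₑ * ‖v p.1 p.2‖ₑ ≤
      ENNReal.ofReal (M * (ball x₀ ρ).indicator (fun _ => (1 : ℝ)) p.2) := by
    intro p
    rw [← ofReal_norm, ← ofReal_norm, ← ENNReal.ofReal_mul (norm_nonneg _)]
    refine ENNReal.ofReal_le_ofReal ?_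
    by_cases hp : p.2 ∈ ball x₀ ρ
    · rw [indicator_of_mem hp, mul_one]; exact hM p.1 p.2
    · rw [indicator_of_notMem hp, mul_zero, hsupp p.1 p.2 hp, norm_zero, zero_mul]
  have hwm : Measurable fun s : ℝ => ENNReal.ofReal ((t - s) ^ (-(1 / 2 : ℝ))) :=
    ENNReal.measurable_ofReal.comp ((measurable_const.sub measurable_id).pow_const _)
  have him : Measurable fun y : E => ENNReal.ofReal (M * (ball x₀ ρ).indicator (fun _ => (1 : ℝ)) y) :=
    ENNReal.measurable_ofReal.comp (measurable_const.mul
      ((measurable_const.indicator measurableSet_ball)))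
  calc ∫⁻ p in Ioo 0 t ×ˢ univ, ENNReal.ofReal ((t - p.1) ^ (-(1 / 2 : ℝ))) *
        (‖u p.1 p.2‖ₑ * ‖v p.1 p.2‖ₑ) ∂(volume : Measure (ℝ × E))
      ≤ ∫⁻ p in Ioo 0 t ×ˢ univ, ENNReal.ofReal ((t - p.1) ^ (-(1 / 2 : ℝ))) *
          ENNReal.ofReal (M * (ball x₀ ρ).indicator (fun _ => (1 : ℝ)) p.2) ∂(volume : Measure (ℝ × E)) :=
        lintegral_mono fun p => by gcongr; exact hpt p
    _ = (∫⁻ s in Ioo 0 t, ENNReal.ofReal ((t - s) ^ (-(1 / 2 : ℝ)))) *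
          ∫⁻ y : E, ENNReal.ofReal (M * (ball x₀ ρ).indicator (fun _ => (1 : ℝ)) y) := by
        rw [FluidPDE.volume_restrict_prod_univ_eq_prod]
        exact lintegral_prod_mul hwm.aemeasurable him.aemeasurable
    _ < ∞ := by
        rw [setLIntegral_Ioo_sub_rpow_neg_half' ht]
        refine ENNReal.mul_lt_top ENNReal.ofReal_lt_top ?_
        rw [← ofReal_integral_eq_lintegral_ofReal (integrable_ballIndicator M x₀ ρ)]
        · exact ENNReal.ofReal_lt_top
        · refine Eventually.of_forall fun y => ?_
          have hM0 : 0 ≤ M := (mul_nonneg (norm_nonneg _) (norm_nonneg _)).trans (hM 0 y)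
          exact mul_nonneg hM0 (indicator_nonneg (fun _ _ => zero_le_one) _)

/-! ### The Fourier coefficients `(u ⊗ v)^_{mk}` -/

/-- **Joint measurability of the Fourier coefficients** `(s, ξ) ↦ (u ⊗ v)^_{mk}(s, ξ)` (a parametric
integral of a jointly measurable integrand). [folklore] -/
theorem stronglyMeasurable_tensorCoeff (hu : StronglyMeasurable (uncurry u))
    (hv : StronglyMeasurable (uncurry v)) (m k : ι) :
    StronglyMeasurable (fun q : ℝ × E => tensorCoeff b u v m k q.1 q.2) := by
  have hg : Measurable (tensorComp b u v m k) := measurable_tensorComp b hu hv m k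
  -- the integrand in the variables `((s, ξ), y)`
  have hF : Measurable (fun z : (ℝ × E) × E =>
      (𝐞 (-⟪z.2, z.1.2⟫) : ℂ) * ((tensorComp b u v m k (z.1.1, z.2) : ℝ) : ℂ)) := by
    refine Measurable.mul ?_ ?_
    · exact (continuous_subtype_val.comp (Real.continuous_fourierChar.comp (by fun_prop))).measurable
    · exact Complex.measurable_ofReal.comp (hg.comp (measurable_fst.fst.prodMk measurable_snd))
  have h := StronglyMeasurable.integral_prod_right' (ν := (volume : Measure E)) hF.stronglyMeasurable
  have heq : (fun q : ℝ × E => tensorCoeff b u v m k q.1 q.2) =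
      fun q => ∫ y, (𝐞 (-⟪y, q.2⟫) : ℂ) * ((tensorComp b u v m k (q.1, y) : ℝ) : ℂ) := by
    funext q
    rw [tensorCoeff, Real.fourier_eq]
    simp_rw [Circle.smul_def, smul_eq_mul]
  rw [heq]
  exact h

/-- For fixed `ξ`, `s ↦ (u ⊗ v)^_{mk}(s, ξ)` is measurable. [folklore] -/
theorem aestronglyMeasurable_tensorCoeff_left (hu : StronglyMeasurable (uncurry u))
    (hv : StronglyMeasurable (uncurry v)) (m k : ι) (ξ : E) :
    AEStronglyMeasurable (fun s : ℝ => tensorCoeff b u v m k s ξ) volume :=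
  ((stronglyMeasurable_tensorCoeff b hu hv m k).comp_measurable
    (measurable_id.prodMk measurable_const)).aestronglyMeasurable

/-- **The Fourier coefficients of a nice tensor are bounded**: `|(u ⊗ v)^_{mk}(s, ξ)| ≤ M |B(x₀, ρ)|`.
[folklore] -/
theorem norm_tensorCoeff_le (hu : StronglyMeasurable (uncurry u))
    (hv : StronglyMeasurable (uncurry v)) {M : ℝ} (hM : ∀ s y, ‖u s y‖ * ‖v s y‖ ≤ M) {x₀ : E} {ρ : ℝ}
    (hsupp : ∀ s y, y ∉ ball x₀ ρ → u s y = 0) (m k : ι) (s : ℝ) (ξ : E) :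
    ‖tensorCoeff b u v m k s ξ‖ ≤ M * (volume (ball x₀ ρ)).toReal := by
  obtain ⟨-, hle, -, -⟩ := integrable_tensorComp_slice b hu hv hM hsupp m k s
  rw [tensorCoeff, Real.fourier_eq]
  refine (norm_integral_le_integral_norm _).trans ?_
  refine le_trans (le_of_eq ?_) hle
  refine integral_congr_ae (Eventually.of_forall fun y => ?_)
  simp only [Circle.norm_smul, Complex.norm_real, Real.norm_eq_abs]

/-! ### The damped primitives `Y_{mk}` -/

/-- The integrand of the slab form of the damped primitive is integrable on the slab. [folklore] -/
theorem integrable_dampedIntegrand_slab (hu : StronglyMeasurable (uncurry u))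
    (hv : StronglyMeasurable (uncurry v)) {M : ℝ} (hM : ∀ s y, ‖u s y‖ * ‖v s y‖ ≤ M) {x₀ : E} {ρ : ℝ}
    (hsupp : ∀ s y, y ∉ ball x₀ ρ → u s y = 0) (m k : ι) {t : ℝ} (ht : 0 ≤ t) (ξ : E) :
    Integrable (fun p : ℝ × E => 𝐞 (-⟪p.2, ξ⟫) •
      (((heatSymbol (t - p.1) ξ * tensorComp b u v m k p : ℝ)) : ℂ))
      ((volume : Measure (ℝ × E)).restrict (Ioo 0 t ×ˢ univ)) := by
  obtain ⟨hgi, -⟩ := integrable_tensorComp_slab b hu hv hM hsupp m k ht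
  have hchar : Continuous fun p : ℝ × E => 𝐞 (-⟪p.2, ξ⟫) :=
    Real.continuous_fourierChar.comp (by fun_prop)
  have hsym : Continuous fun p : ℝ × E => heatSymbol (t - p.1) ξ := by
    unfold heatSymbol; fun_prop
  have h1 : Integrable (fun p : ℝ × E => ((heatSymbol (t - p.1) ξ * tensorComp b u v m k p : ℝ) : ℂ))
      ((volume : Measure (ℝ × E)).restrict (Ioo 0 t ×ˢ univ)) := by
    refine (Integrable.bdd_mul (c := 1) hgi hsym.aestronglyMeasurable ?_).ofReal
    refine (ae_restrict_iff' (measurableSet_Ioo.prod MeasurableSet.univ)).2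
      (Eventually.of_forall fun p hp => ?_)
    rw [mem_prod] at hp
    rw [Real.norm_eq_abs, abs_of_pos (UnboundedOperators.heatSymbol_pos _ _)]
    exact UnboundedOperators.heatSymbol_le_one (sub_pos.2 hp.1.2).le ξ
  refine h1.norm.mono' (hchar.aestronglyMeasurable.smul h1.1) (Eventually.of_forall fun p => ?_)
  rw [Circle.norm_smul]

/-- **The damped primitive as a slab integral**: for a nice tensor and `t ≥ 0`,
`Y_{mk}(t, ξ) = ∫_{(0,t) × E} e^{-2πi⟪y,ξ⟫} e^{-(2π)²(t-s)|ξ|²} (u ⊗ v)_{mk}(s, y) d(s,y)` (Fubini on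
the slab; this is the right-hand side of `fourier_heatPotential_slice` and, summed against the
symbol, of `fourier_inner_kochTataruBilinear_slice`). [folklore] -/
theorem dampedCoeff_eq_setIntegral (hu : StronglyMeasurable (uncurry u))
    (hv : StronglyMeasurable (uncurry v)) {M : ℝ} (hM : ∀ s y, ‖u s y‖ * ‖v s y‖ ≤ M) {x₀ : E} {ρ : ℝ}
    (hsupp : ∀ s y, y ∉ ball x₀ ρ → u s y = 0) (m k : ι) {t : ℝ} (ht : 0 ≤ t) (ξ : E) :
    dampedCoeff b u v m k t ξ =
      ∫ p in Ioo 0 t ×ˢ univ, 𝐞 (-⟪p.2, ξ⟫) •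
        (((heatSymbol (t - p.1) ξ * tensorComp b u v m k p : ℝ)) : ℂ) ∂(volume : Measure (ℝ × E)) := by
  have hint := integrable_dampedIntegrand_slab b hu hv hM hsupp m k ht ξ
  rw [FluidPDE.volume_restrict_prod_univ_eq_prod] at hint
  rw [FluidPDE.volume_restrict_prod_univ_eq_prod, integral_prod _ hint, dampedCoeff]
  refine setIntegral_congr_fun measurableSet_Ioo fun s hs => ?_
  rw [tensorCoeff, Real.fourier_eq, ← integral_const_mul]
  refine integral_congr_ae (Eventually.of_forall fun y => ?_)
  simp only [Circle.smul_def, smul_eq_mul, Complex.ofReal_mul, heatSymbol_sub_eq_exp]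
  ring

/-- **The damped primitives of a nice tensor are bounded**: `‖Y_{mk}(t, ξ)‖ ≤ t M |B(x₀, ρ)|`
(`t ≥ 0`). [folklore] -/
theorem norm_dampedCoeff_le (hu : StronglyMeasurable (uncurry u))
    (hv : StronglyMeasurable (uncurry v)) {M : ℝ} (hM : ∀ s y, ‖u s y‖ * ‖v s y‖ ≤ M) {x₀ : E} {ρ : ℝ}
    (hsupp : ∀ s y, y ∉ ball x₀ ρ → u s y = 0) (m k : ι) {t : ℝ} (ht : 0 ≤ t) (ξ : E) :
    ‖dampedCoeff b u v m k t ξ‖ ≤ t * (M * (volume (ball x₀ ρ)).toReal) := by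
  rw [dampedCoeff]
  have h := norm_setIntegral_le_of_norm_le_const (μ := (volume : Measure ℝ)) (s := Ioo 0 t)
    measure_Ioo_lt_top
    (f := fun s => (Real.exp (-((2 * π) ^ 2 * ‖ξ‖ ^ 2 * (t - s))) : ℂ) * tensorCoeff b u v m k s ξ)
    (C := M * (volume (ball x₀ ρ)).toReal) (fun s hs => ?_)
  · rw [Real.volume_real_Ioo_of_le ht, sub_zero] at h
    exact h.trans (le_of_eq (by ring))
  · rw [norm_mul, Complex.norm_real, Real.norm_eq_abs, Real.abs_exp]
    have hexp : Real.exp (-((2 * π) ^ 2 * ‖ξ‖ ^ 2 * (t - s))) ≤ 1 := by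
      rw [Real.exp_le_one_iff, neg_nonpos]
      exact mul_nonneg (by positivity) (sub_nonneg.2 hs.2.le)
    calc Real.exp (-((2 * π) ^ 2 * ‖ξ‖ ^ 2 * (t - s))) * ‖tensorCoeff b u v m k s ξ‖
        ≤ 1 * (M * (volume (ball x₀ ρ)).toReal) :=
          mul_le_mul hexp (norm_tensorCoeff_le b hu hv hM hsupp m k s ξ) (norm_nonneg _) zero_le_one
      _ = _ := one_mul _

/-- **Joint measurability of the damped primitives** `(t, ξ) ↦ Y_{mk}(t, ξ)`. [folklore] -/
theorem stronglyMeasurable_dampedCoeff (hu : StronglyMeasurable (uncurry u))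
    (hv : StronglyMeasurable (uncurry v)) (m k : ι) :
    StronglyMeasurable (fun q : ℝ × E => dampedCoeff b u v m k q.1 q.2) := by
  have hΓ := stronglyMeasurable_tensorCoeff b hu hv m k
  set S : Set ((ℝ × E) × ℝ) := {z | 0 < z.2 ∧ z.2 < z.1.1} with hS
  have hSm : MeasurableSet S :=
    (measurableSet_lt measurable_const measurable_snd).inter
      (measurableSet_lt measurable_snd measurable_fst.fst)
  set F : (ℝ × E) × ℝ → ℂ := fun z =>
    (Real.exp (-((2 * π) ^ 2 * ‖z.1.2‖ ^ 2 * (z.1.1 - z.2))) : ℂ) * tensorCoeff b u v m k z.2 z.1.2 with hF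
  have hFm : StronglyMeasurable F := by
    refine Measurable.stronglyMeasurable (Measurable.mul ?_ ?_)
    · exact (Complex.continuous_ofReal.comp (by fun_prop)).measurable
    · exact hΓ.measurable.comp (measurable_snd.prodMk measurable_fst.snd)
  have hI := (hFm.indicator hSm).integral_prod_right' (ν := (volume : Measure ℝ))
  have heq : (fun q : ℝ × E => dampedCoeff b u v m k q.1 q.2) = fun q => ∫ s, S.indicator F (q, s) := by
    funext q
    rw [dampedCoeff, ← integral_indicator measurableSet_Ioo]
    congr 1 with s
  rw [heq]
  exact hI

/-! ### The heat potentials `V(u ⊗ v)_{mk}` -/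

/-- **Joint measurability of the heat potentials** `(t, x) ↦ V(u ⊗ v)_{mk}(t, x)`. [folklore] -/
theorem stronglyMeasurable_heatPotentialComp (hu : StronglyMeasurable (uncurry u))
    (hv : StronglyMeasurable (uncurry v)) (m k : ι) :
    StronglyMeasurable (fun q : ℝ × E => heatPotentialComp b u v m k q.1 q.2) := by
  have hg : Measurable (tensorComp b u v m k) := measurable_tensorComp b hu hv m k
  set S : Set ((ℝ × E) × (ℝ × E)) := {z | 0 < z.2.1 ∧ z.2.1 < z.1.1} with hS
  have hSm : MeasurableSet S :=
    (measurableSet_lt measurable_const measurable_snd.fst).inter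
      (measurableSet_lt measurable_snd.fst measurable_fst.fst)
  set F : (ℝ × E) × (ℝ × E) → ℝ := fun z =>
    heatKernel (z.1.1 - z.2.1) (z.1.2 - z.2.2) * tensorComp b u v m k z.2 with hF
  have hFm : StronglyMeasurable F := by
    refine Measurable.stronglyMeasurable (Measurable.mul ?_ (hg.comp measurable_snd))
    exact measurable_heatKernel_uncurry.comp
      ((measurable_fst.fst.sub measurable_snd.fst).prodMk (measurable_fst.snd.sub measurable_snd.snd))
  have hI := (hFm.indicator hSm).integral_prod_right' (ν := (volume : Measure (ℝ × E)))
  have heq : (fun q : ℝ × E => heatPotentialComp b u v m k q.1 q.2) = fun q => ∫ p, S.indicator F (q, p) := by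
    funext q
    rw [heatPotentialComp, ← integral_indicator (measurableSet_Ioo.prod MeasurableSet.univ)]
    congr 1 with p
    simp only [indicator, hS, hF, mem_setOf_eq, mem_prod, mem_Ioo, mem_univ, and_true]
  rw [heq]
  exact hI

/-- Measurability of a slice `x ↦ V(u ⊗ v)_{mk}(t, x)`. [folklore] -/
theorem measurable_heatPotentialComp_slice (hu : StronglyMeasurable (uncurry u))
    (hv : StronglyMeasurable (uncurry v)) (m k : ι) (t : ℝ) :
    Measurable (heatPotentialComp b u v m k t) :=
  (stronglyMeasurable_heatPotentialComp b hu hv m k).measurable.comp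
    (measurable_const.prodMk measurable_id)

/-- **The heat potentials are dominated by the heat potential of `|u| |v|`** and hence, by
Koch–Tataru's (20) (`exists_setLIntegral_heatKernel_mul_le`), bounded by `C ‖u‖_X ‖v‖_X`:
`‖V(u ⊗ v)_{mk}(t, x)‖ ≤ ∫_{(0,t) × E} G_{t-s}(x-y) ‖u(s,y)‖ ‖v(s,y)‖`. [cite: KochTataruAdvMath2001, Remark 3.3 (20)] -/
theorem enorm_heatPotentialComp_le (u v : ℝ → E → E) (m k : ι) (t : ℝ) (x : E) :
    ‖heatPotentialComp b u v m k t x‖ₑ ≤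
      ∫⁻ p in Ioo 0 t ×ˢ univ, ENNReal.ofReal (heatKernel (t - p.1) (x - p.2)) *
        (‖u p.1 p.2‖ₑ * ‖v p.1 p.2‖ₑ) ∂(volume : Measure (ℝ × E)) := by
  rw [heatPotentialComp]
  refine (enorm_integral_le_lintegral_enorm _).trans (setLIntegral_mono' 
    (measurableSet_Ioo.prod MeasurableSet.univ) fun p hp => ?_)
  rw [mem_prod] at hp
  have hG : 0 ≤ heatKernel (t - p.1) (x - p.2) :=
    (UnboundedOperators.heatKernel_pos (sub_pos.2 hp.1.2) _).le
  rw [enorm_mul, Real.enorm_eq_ofReal hG]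
  gcongr
  rw [← ofReal_norm, ← ofReal_norm, ← ofReal_norm, ← ENNReal.ofReal_mul (norm_nonneg _), Real.norm_eq_abs]
  exact ENNReal.ofReal_le_ofReal (abs_tensorComp_le b u v m k p)

/-- **The heat potentials of a nice tensor are integrable in `x`**, with
`∫ |V(u ⊗ v)_{mk}(t, x)| dx ≤ ∫_{(0,t) × E} |(u ⊗ v)_{mk}| ≤ t M |B(x₀, ρ)|` (Tonelli and `∫ G_τ = 1`).
[folklore] -/
theorem integrable_heatPotentialComp_slice (hu : StronglyMeasurable (uncurry u))
    (hv : StronglyMeasurable (uncurry v)) {M : ℝ} (hM : ∀ s y, ‖u s y‖ * ‖v s y‖ ≤ M) {x₀ : E} {ρ : ℝ}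
    (hsupp : ∀ s y, y ∉ ball x₀ ρ → u s y = 0) (m k : ι) {t : ℝ} (ht : 0 ≤ t) :
    Integrable (heatPotentialComp b u v m k t) ∧
      ∫⁻ x, ‖heatPotentialComp b u v m k t x‖ₑ ≤ ENNReal.ofReal (t * (M * (volume (ball x₀ ρ)).toReal)) := by
  obtain ⟨hgi, hgle⟩ := integrable_tensorComp_slab b hu hv hM hsupp m k ht
  set μ : Measure (ℝ × E) := (volume : Measure (ℝ × E)).restrict (Ioo 0 t ×ˢ univ) with hμ
  have hg : Measurable (tensorComp b u v m k) := measurable_tensorComp b hu hv m k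
  -- the majorant `∫⁻ ofReal(G) ‖g‖` and its `x`-integral
  have hHm : Measurable (fun z : E × (ℝ × E) =>
      ENNReal.ofReal (heatKernel (t - z.2.1) (z.1 - z.2.2)) * ‖tensorComp b u v m k z.2‖ₑ) := by
    refine Measurable.mul (ENNReal.measurable_ofReal.comp ?_) (hg.comp measurable_snd).enorm
    exact measurable_heatKernel_uncurry.comp
      ((measurable_const.sub measurable_snd.fst).prodMk (measurable_fst.sub measurable_snd.snd))
  have hpt : ∀ x, ‖heatPotentialComp b u v m k t x‖ₑ ≤
      ∫⁻ p, ENNReal.ofReal (heatKernel (t - p.1) (x - p.2)) * ‖tensorComp b u v m k p‖ₑ ∂μ := by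
    intro x
    rw [heatPotentialComp]
    refine (enorm_integral_le_lintegral_enorm _).trans (setLIntegral_mono'
      (measurableSet_Ioo.prod MeasurableSet.univ) fun p hp => ?_)
    rw [mem_prod] at hp
    rw [enorm_mul, Real.enorm_eq_ofReal (UnboundedOperators.heatKernel_pos (sub_pos.2 hp.1.2) _).le]
  have hswap : ∫⁻ x, ∫⁻ p, ENNReal.ofReal (heatKernel (t - p.1) (x - p.2)) * ‖tensorComp b u v m k p‖ₑ ∂μ =
      ∫⁻ p, ‖tensorComp b u v m k p‖ₑ ∂μ := by
    rw [lintegral_lintegral_swap (hHm.aemeasurable)]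
    refine setLIntegral_congr_fun (measurableSet_Ioo.prod MeasurableSet.univ) fun p hp => ?_
    rw [mem_prod] at hp
    have hτ : 0 < t - p.1 := sub_pos.2 hp.1.2
    have hGm : Measurable fun x : E => ENNReal.ofReal (heatKernel (t - p.1) (x - p.2)) :=
      ENNReal.measurable_ofReal.comp ((UnboundedOperators.continuous_heatKernel _).measurable.comp
        (measurable_id.sub measurable_const))
    rw [lintegral_mul_const _ hGm,
      lintegral_sub_right_eq_self (fun z => ENNReal.ofReal (heatKernel (t - p.1) z)) p.2]
    have h1 : ∫⁻ z : E, ENNReal.ofReal (heatKernel (t - p.1) z) = 1 := by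
      rw [← UnboundedOperators.lintegral_enorm_heatKernel (E := E) hτ]
      exact lintegral_congr fun z => (Real.enorm_eq_ofReal (UnboundedOperators.heatKernel_pos hτ z).le).symm
    rw [h1, one_mul]
  have hbound : ∫⁻ x, ‖heatPotentialComp b u v m k t x‖ₑ ≤ ENNReal.ofReal (t * (M * (volume (ball x₀ ρ)).toReal)) := by
    calc ∫⁻ x, ‖heatPotentialComp b u v m k t x‖ₑ
        ≤ ∫⁻ x, ∫⁻ p, ENNReal.ofReal (heatKernel (t - p.1) (x - p.2)) * ‖tensorComp b u v m k p‖ₑ ∂μ :=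
          lintegral_mono hpt
      _ = ∫⁻ p, ‖tensorComp b u v m k p‖ₑ ∂μ := hswap
      _ = ENNReal.ofReal (∫ p, |tensorComp b u v m k p| ∂μ) := by
          rw [ofReal_integral_eq_lintegral_ofReal hgi.abs (Eventually.of_forall fun _ => abs_nonneg _)]
          exact lintegral_congr fun p => by rw [← Real.enorm_abs, Real.enorm_eq_ofReal (abs_nonneg _)]
      _ ≤ ENNReal.ofReal (t * (M * (volume (ball x₀ ρ)).toReal)) := ENNReal.ofReal_le_ofReal hgle
  refine ⟨⟨(measurable_heatPotentialComp_slice b hu hv m k t).aestronglyMeasurable, ?_⟩, hbound⟩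
  rw [hasFiniteIntegral_iff_enorm]
  exact hbound.trans_lt ENNReal.ofReal_lt_top

/-- **The `x`-Fourier transform of the heat potential is the damped primitive of the Fourier
coefficient**: `𝓕_x V(u ⊗ v)_{mk}(t, ·)(ξ) = Y_{mk}(t, ξ)` (`t ≥ 0`; `fourier_heatPotential_slice`
and Fubini on the slab). [cite: KochTataruAdvMath2001, Lemma 3.2 Step 4 (16)] -/
theorem fourier_heatPotentialComp (hu : StronglyMeasurable (uncurry u))
    (hv : StronglyMeasurable (uncurry v)) {M : ℝ} (hM : ∀ s y, ‖u s y‖ * ‖v s y‖ ≤ M) {x₀ : E} {ρ : ℝ}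
    (hsupp : ∀ s y, y ∉ ball x₀ ρ → u s y = 0) (m k : ι) {t : ℝ} (ht : 0 ≤ t) (ξ : E) :
    𝓕 (fun x => (heatPotentialComp b u v m k t x : ℂ)) ξ = dampedCoeff b u v m k t ξ := by
  obtain ⟨hgi, -⟩ := integrable_tensorComp_slab b hu hv hM hsupp m k ht
  rw [dampedCoeff_eq_setIntegral b hu hv hM hsupp m k ht ξ]
  exact fourier_heatPotential_slice hgi ξ

/-! ### The Fourier transform of the slices of `B(u, v)` in coordinates -/

omit [FiniteDimensional ℝ E] [MeasurableSpace E] [BorelSpace E] in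
/-- Coordinates of the symbol: `⟪ξ, a⟫ = ∑ₘ ⟪ξ, bₘ⟫ ⟪a, bₘ⟫` and
`⟪P(ξ)c, bⱼ⟫ = ∑ₖ ⟪c, bₖ⟫ ⟪P(ξ)bₖ, bⱼ⟫`, whence
`⟪ξ, a⟫ ⟪P(ξ)c, bⱼ⟫ = ∑ₘ ∑ₖ ⟪ξ, bₘ⟫ ⟪P(ξ)bₖ, bⱼ⟫ (⟪a, bₘ⟫ ⟪c, bₖ⟫)`. [folklore] -/
theorem inner_mul_inner_leraySymbol_eq_sum (ξ a c : E) (j : ι) :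
    ⟪ξ, a⟫ * ⟪leraySymbol ξ c, b j⟫ =
      ∑ m, ∑ k, ⟪ξ, b m⟫ * ⟪leraySymbol ξ (b k), b j⟫ * (⟪a, b m⟫ * ⟪c, b k⟫) := by
  have h1 : ⟪ξ, a⟫ = ∑ m, ⟪ξ, b m⟫ * ⟪a, b m⟫ := by
    rw [← b.sum_inner_mul_inner ξ a]
    exact Finset.sum_congr rfl fun m _ => by rw [real_inner_comm (b m) a]
  have h2 : ⟪leraySymbol ξ c, b j⟫ = ∑ k, ⟪c, b k⟫ * ⟪leraySymbol ξ (b k), b j⟫ := by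
    conv_lhs => rw [← b.sum_repr' c]
    rw [map_sum, sum_inner]
    refine Finset.sum_congr rfl fun k _ => ?_
    rw [map_smul, real_inner_smul_left, real_inner_comm (b k) c]
  rw [h1, h2, Finset.sum_mul_sum]
  refine Finset.sum_congr rfl fun m _ => Finset.sum_congr rfl fun k _ => ?_
  ring

/-- **The Fourier transform of the slices of `B(u, v)` in coordinates** (Koch–Tataru 2001, §2–3:
`𝓕_x(V∇ΠN(u))` is the symbol `2πi ⟪ξ, ·⟫ P(ξ)` against the damped primitives): for a nice tensor with
finite Koch–Tataru norms and `t > 0`,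
`𝓕_x ⟪B(u,v)(t), bⱼ⟫ (ξ) = 2πi ∑ₘ ∑ₖ ⟪ξ, bₘ⟫ ⟪P(ξ)bₖ, bⱼ⟫ Y_{mk}(t, ξ)`. [cite: KochTataruAdvMath2001, §2 (6)–(8), §3 (11), (16)] -/
theorem fourier_inner_kochTataruBilinear_eq_sum (hu : StronglyMeasurable (uncurry u))
    (hv : StronglyMeasurable (uncurry v)) {M : ℝ} (hM : ∀ s y, ‖u s y‖ * ‖v s y‖ ≤ M) {x₀ : E} {ρ : ℝ}
    (hsupp : ∀ s y, y ∉ ball x₀ ρ → u s y = 0) (huX : eKochTataruNorm u < ∞) (hvX : eKochTataruNorm v < ∞)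
    {t : ℝ} (ht : 0 < t) (j : ι) (ξ : E) :
    𝓕 (fun x => ((⟪kochTataruBilinear u v t x, b j⟫ : ℝ) : ℂ)) ξ =
      ∑ m, ∑ k, (2 * π * Complex.I * (⟪ξ, b m⟫ : ℝ) * (⟪leraySymbol ξ (b k), b j⟫ : ℝ)) *
        dampedCoeff b u v m k t ξ := by
  have hL1 := lintegral_majorant_lt_top (u := u) (v := v) hM hsupp ht
  have hu' : AEStronglyMeasurable (uncurry u) ((volume : Measure (ℝ × E)).restrict (Ioi 0 ×ˢ univ)) :=
    hu.aestronglyMeasurable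
  have hv' : AEStronglyMeasurable (uncurry v) ((volume : Measure (ℝ × E)).restrict (Ioi 0 ×ˢ univ)) :=
    hv.aestronglyMeasurable
  rw [fourier_inner_kochTataruBilinear_slice hu' hv' huX hvX ht hL1 (b j) ξ]
  set μ : Measure (ℝ × E) := (volume : Measure (ℝ × E)).restrict (Ioo 0 t ×ˢ univ) with hμ
  -- the integrand, expanded in coordinates
  set F : ι → ι → ℝ × E → ℂ := fun m k p => 𝐞 (-⟪p.2, ξ⟫) •
    (((heatSymbol (t - p.1) ξ * tensorComp b u v m k p : ℝ)) : ℂ) with hF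
  set c : ι → ι → ℂ := fun m k => 2 * π * Complex.I * (⟪ξ, b m⟫ : ℂ) * (⟪leraySymbol ξ (b k), b j⟫ : ℂ)
    with hc
  have hexp : ∀ p : ℝ × E, 𝐞 (-⟪p.2, ξ⟫) •
      (2 * π * Complex.I * (⟪ξ, u p.1 p.2⟫ : ℝ) * (heatSymbol (t - p.1) ξ : ℝ) *
        (⟪leraySymbol ξ (v p.1 p.2), b j⟫ : ℝ)) = ∑ m, ∑ k, c m k * F m k p := by
    intro p
    have key : (2 * π * Complex.I * (⟪ξ, u p.1 p.2⟫ : ℝ) * (heatSymbol (t - p.1) ξ : ℝ) *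
        (⟪leraySymbol ξ (v p.1 p.2), b j⟫ : ℝ) : ℂ) =
        ∑ m, ∑ k, c m k * (((heatSymbol (t - p.1) ξ * tensorComp b u v m k p : ℝ)) : ℂ) := by
      have h := inner_mul_inner_leraySymbol_eq_sum b ξ (u p.1 p.2) (v p.1 p.2) j
      have h' : ((⟪ξ, u p.1 p.2⟫ : ℝ) : ℂ) * ((⟪leraySymbol ξ (v p.1 p.2), b j⟫ : ℝ) : ℂ) =
          ∑ m, ∑ k, ((⟪ξ, b m⟫ : ℝ) : ℂ) * ((⟪leraySymbol ξ (b k), b j⟫ : ℝ) : ℂ) *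
            ((tensorComp b u v m k p : ℝ) : ℂ) := by
        unfold tensorComp
        exact_mod_cast h
      calc (2 * π * Complex.I * (⟪ξ, u p.1 p.2⟫ : ℝ) * (heatSymbol (t - p.1) ξ : ℝ) *
            (⟪leraySymbol ξ (v p.1 p.2), b j⟫ : ℝ) : ℂ)
          = 2 * π * Complex.I * (heatSymbol (t - p.1) ξ : ℝ) *
              (((⟪ξ, u p.1 p.2⟫ : ℝ) : ℂ) * ((⟪leraySymbol ξ (v p.1 p.2), b j⟫ : ℝ) : ℂ)) := by ring
        _ = 2 * π * Complex.I * (heatSymbol (t - p.1) ξ : ℝ) *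
              ∑ m, ∑ k, ((⟪ξ, b m⟫ : ℝ) : ℂ) * ((⟪leraySymbol ξ (b k), b j⟫ : ℝ) : ℂ) *
                ((tensorComp b u v m k p : ℝ) : ℂ) := by rw [h']
        _ = _ := by
            rw [Finset.mul_sum]
            refine Finset.sum_congr rfl fun m _ => ?_
            rw [Finset.mul_sum]
            refine Finset.sum_congr rfl fun k _ => ?_
            simp only [hc, Complex.ofReal_mul]
            ring
    rw [key, Finset.smul_sum]
    refine Finset.sum_congr rfl fun m _ => ?_
    rw [Finset.smul_sum]
    refine Finset.sum_congr rfl fun k _ => ?_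
    simp only [hF, Circle.smul_def, smul_eq_mul]
    ring
  -- integrate term by term
  have hFi : ∀ m k, Integrable (F m k) μ := fun m k =>
    integrable_dampedIntegrand_slab b hu hv hM hsupp m k ht.le ξ
  calc ∫ p, 𝐞 (-⟪p.2, ξ⟫) • (2 * π * Complex.I * (⟪ξ, u p.1 p.2⟫ : ℝ) * (heatSymbol (t - p.1) ξ : ℝ) *
          (⟪leraySymbol ξ (v p.1 p.2), b j⟫ : ℝ)) ∂μ
      = ∫ p, ∑ m, ∑ k, c m k * F m k p ∂μ := integral_congr_ae (Eventually.of_forall hexp)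
    _ = ∑ m, ∑ k, c m k * ∫ p, F m k p ∂μ := by
        rw [integral_finsetSum _ fun m _ => integrable_finsetSum _ fun k _ => (hFi m k).const_mul _]
        refine Finset.sum_congr rfl fun m _ => ?_
        rw [integral_finsetSum _ fun k _ => (hFi m k).const_mul _]
        refine Finset.sum_congr rfl fun k _ => ?_
        exact integral_const_mul _ _
    _ = ∑ m, ∑ k, (2 * π * Complex.I * (⟪ξ, b m⟫ : ℝ) * (⟪leraySymbol ξ (b k), b j⟫ : ℝ)) *
          dampedCoeff b u v m k t ξ := by
        refine Finset.sum_congr rfl fun m _ => Finset.sum_congr rfl fun k _ => ?_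
        rw [dampedCoeff_eq_setIntegral b hu hv hM hsupp m k ht.le ξ, hc]

/-! ### Plancherel for the slices of `B(u, v)` and the symbol bound -/

omit [InnerProductSpace ℝ E] [FiniteDimensional ℝ E] [MeasurableSpace E] [BorelSpace E] [Fintype ι] in
/-- `‖z‖ₑ² = ofReal (‖z‖²)`. [folklore] -/
theorem enorm_sq_eq_ofReal_norm_sq' {F : Type*} [SeminormedAddCommGroup F] (z : F) :
    ‖z‖ₑ ^ 2 = ENNReal.ofReal (‖z‖ ^ 2) := by
  rw [← ofReal_norm, ENNReal.ofReal_pow (norm_nonneg _)]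

/-- **The slices of `B(u, v)` of a nice tensor are bounded** (real form of
`exists_enorm_kochTataruBilinear_le` for finite norms). [cite: KochTataruAdvMath2001, Lemma 3.2 (12)] -/
theorem exists_norm_kochTataruBilinear_slice_le {u v : ℝ → E → E}
    (hu : AEStronglyMeasurable (uncurry u) ((volume : Measure (ℝ × E)).restrict (Ioi 0 ×ˢ univ)))
    (hv : AEStronglyMeasurable (uncurry v) ((volume : Measure (ℝ × E)).restrict (Ioi 0 ×ˢ univ)))
    (huX : eKochTataruNorm u < ∞) (hvX : eKochTataruNorm v < ∞) {t : ℝ} (ht : 0 < t) :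
    ∃ C : ℝ, ∀ x : E, ‖kochTataruBilinear u v t x‖ ≤ C := by
  obtain ⟨C, -, h⟩ := exists_enorm_kochTataruBilinear_le (E := E)
  set K : ℝ≥0∞ := ENNReal.ofReal (C * t ^ (-(1 / 2 : ℝ))) * eKochTataruNorm u * eKochTataruNorm v with hK
  have hKtop : K ≠ ∞ := ENNReal.mul_ne_top (ENNReal.mul_ne_top ENNReal.ofReal_ne_top huX.ne) hvX.ne
  refine ⟨K.toReal, fun x => ?_⟩
  have hx := h hu hv ht x
  calc ‖kochTataruBilinear u v t x‖ = (‖kochTataruBilinear u v t x‖ₑ).toReal := by simp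
    _ ≤ K.toReal := ENNReal.toReal_mono hKtop hx

/-- **Plancherel for the slices of `B(u, v)` and the symbol bound** (Koch–Tataru 2001, Lemma 3.2,
Step 3: "we have dispensed with `Π`, which is a bounded operator in `L²`"): for a nice tensor with
finite Koch–Tataru norms and `t > 0`,
`∫ ‖B(u,v)(t,x)‖² dx ≤ ∫ (2π)² |ξ|² ∑ₘ ∑ₖ |Y_{mk}(t, ξ)|² dξ` (in `ℝ≥0∞`; the slice is in `L¹ ∩ L²`,
Plancherel componentwise, the coordinate form of its Fourier transform, and the contraction
`sum_norm_sq_symbol_le`). [cite: KochTataruAdvMath2001, Lemma 3.2 Step 3 (13), (15)] -/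
theorem lintegral_enorm_sq_kochTataruBilinear_slice_le (hu : StronglyMeasurable (uncurry u))
    (hv : StronglyMeasurable (uncurry v)) {M : ℝ} (hM : ∀ s y, ‖u s y‖ * ‖v s y‖ ≤ M) {x₀ : E} {ρ : ℝ}
    (hsupp : ∀ s y, y ∉ ball x₀ ρ → u s y = 0) (huX : eKochTataruNorm u < ∞) (hvX : eKochTataruNorm v < ∞)
    {t : ℝ} (ht : 0 < t) :
    ∫⁻ x, ‖kochTataruBilinear u v t x‖ₑ ^ 2 ≤
      ∫⁻ ξ, ENNReal.ofReal ((2 * π) ^ 2 * ‖ξ‖ ^ 2 * ∑ m, ∑ k, ‖dampedCoeff b u v m k t ξ‖ ^ 2) := by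
  have hL1 := lintegral_majorant_lt_top (u := u) (v := v) hM hsupp ht
  have hu' : AEStronglyMeasurable (uncurry u) ((volume : Measure (ℝ × E)).restrict (Ioi 0 ×ˢ univ)) :=
    hu.aestronglyMeasurable
  have hv' : AEStronglyMeasurable (uncurry v) ((volume : Measure (ℝ × E)).restrict (Ioi 0 ×ˢ univ)) :=
    hv.aestronglyMeasurable
  set B : E → E := kochTataruBilinear u v t with hB
  have hBi : Integrable B := integrable_kochTataruBilinear_slice hu' hv' hL1
  obtain ⟨C, hC⟩ := exists_norm_kochTataruBilinear_slice_le hu' hv' huX hvX ht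
  set f : ι → E → ℂ := fun j x => ((⟪B x, b j⟫ : ℝ) : ℂ) with hf
  have hfi : ∀ j, Integrable (f j) := fun j => (hBi.inner_const (b j)).ofReal
  have hfb : ∀ j x, ‖f j x‖ ≤ C := fun j x => by
    simp only [hf, Complex.norm_real, Real.norm_eq_abs]
    calc |⟪B x, b j⟫| ≤ ‖B x‖ * ‖b j‖ := abs_real_inner_le_norm _ _
      _ = ‖B x‖ := by rw [b.orthonormal.1 j, mul_one]
      _ ≤ C := hC x
  have hf2 : ∀ j, MemLp (f j) 2 := fun j => memLp_two_of_integrable_of_bound (hfi j) (hfb j)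
  -- Step 1: `‖B x‖² = ∑ⱼ ‖f j x‖²`
  have hpt : ∀ x, ‖B x‖ₑ ^ 2 = ∑ j, ‖f j x‖ₑ ^ 2 := by
    intro x
    rw [enorm_sq_eq_ofReal_norm_sq', ← b.sum_sq_inner_left (B x), ENNReal.ofReal_sum_of_nonneg
      (fun j _ => sq_nonneg _)]
    refine Finset.sum_congr rfl fun j _ => ?_
    rw [enorm_sq_eq_ofReal_norm_sq', hf]
    simp only [Complex.norm_real, Real.norm_eq_abs, sq_abs]
  -- Step 2: Plancherel componentwise
  have hplan : ∀ j, ∫⁻ x, ‖f j x‖ₑ ^ 2 = ∫⁻ ξ, ‖𝓕 (f j) ξ‖ₑ ^ 2 := fun j =>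
    (FunctionSpaces.lintegral_enorm_sq_fourierIntegral_eq (hfi j) (hf2 j)).symm
  have hFm : ∀ j, AEMeasurable (fun ξ => ‖𝓕 (f j) ξ‖ₑ ^ 2) (volume : Measure E) := fun j =>
    ((FunctionSpaces.continuous_fourierIntegral (hfi j)).measurable.enorm.pow_const 2).aemeasurable
  -- Step 3: the symbol bound, pointwise in `ξ`
  have hsym : ∀ ξ : E, ∑ j, ‖𝓕 (f j) ξ‖ₑ ^ 2 ≤
      ENNReal.ofReal ((2 * π) ^ 2 * ‖ξ‖ ^ 2 * ∑ m, ∑ k, ‖dampedCoeff b u v m k t ξ‖ ^ 2) := by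
    intro ξ
    have hj : ∀ j, 𝓕 (f j) ξ = ∑ m, ∑ k, (2 * π * Complex.I * (⟪ξ, b m⟫ : ℝ) *
        (⟪leraySymbol ξ (b k), b j⟫ : ℝ)) * dampedCoeff b u v m k t ξ := fun j =>
      fourier_inner_kochTataruBilinear_eq_sum b hu hv hM hsupp huX hvX ht j ξ
    calc ∑ j, ‖𝓕 (f j) ξ‖ₑ ^ 2 = ENNReal.ofReal (∑ j, ‖𝓕 (f j) ξ‖ ^ 2) := by
          rw [ENNReal.ofReal_sum_of_nonneg (fun j _ => sq_nonneg _)]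
          exact Finset.sum_congr rfl fun j _ => enorm_sq_eq_ofReal_norm_sq' _
      _ ≤ _ := by
          refine ENNReal.ofReal_le_ofReal ?_
          simp_rw [hj]
          exact sum_norm_sq_sum_oseenSymbol_mul_le b ξ _
  -- assemble
  calc ∫⁻ x, ‖B x‖ₑ ^ 2 = ∫⁻ x, ∑ j, ‖f j x‖ₑ ^ 2 := lintegral_congr hpt
    _ = ∑ j, ∫⁻ x, ‖f j x‖ₑ ^ 2 :=
        lintegral_finsetSum' _ fun j _ => ((hfi j).1.aemeasurable.enorm.pow_const 2)
    _ = ∑ j, ∫⁻ ξ, ‖𝓕 (f j) ξ‖ₑ ^ 2 := Finset.sum_congr rfl fun j _ => hplan j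
    _ = ∫⁻ ξ, ∑ j, ‖𝓕 (f j) ξ‖ₑ ^ 2 := (lintegral_finsetSum' _ fun j _ => hFm j).symm
    _ ≤ _ := lintegral_mono hsym

/-! ### The energy inequality, mode by mode -/

/-- For fixed `ξ`, the Fourier coefficients of a nice tensor are integrable on `(0, T)`. [folklore] -/
theorem integrableOn_tensorCoeff_left (hu : StronglyMeasurable (uncurry u))
    (hv : StronglyMeasurable (uncurry v)) {M : ℝ} (hM : ∀ s y, ‖u s y‖ * ‖v s y‖ ≤ M) {x₀ : E} {ρ : ℝ}
    (hsupp : ∀ s y, y ∉ ball x₀ ρ → u s y = 0) (m k : ι) (T : ℝ) (ξ : E) :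
    IntegrableOn (fun s : ℝ => tensorCoeff b u v m k s ξ) (Ioo 0 T) :=
  Measure.integrableOn_of_bounded (M := M * (volume (ball x₀ ρ)).toReal) measure_Ioo_lt_top.ne
    (aestronglyMeasurable_tensorCoeff_left b hu hv m k ξ)
    (Eventually.of_forall fun s => norm_tensorCoeff_le b hu hv hM hsupp m k s ξ)

/-- **Koch–Tataru's energy inequality (21), mode by mode** (`KochTataruEnergy.lean`, applied to
`h = (u ⊗ v)^_{mk}(·, ξ)`, `a = (2π)²|ξ|²`): for a nice tensor and `T > 0`,
`(2π)²|ξ|² ∫₀ᵀ |Y_{mk}(t, ξ)|² dt ≤ Re ∫₀ᵀ conj(Y_{mk}(t, ξ)) (u ⊗ v)^_{mk}(t, ξ) dt`. [cite: KochTataruAdvMath2001, Remark 3.3 (21), Lemma 3.2 Step 4 (17)] -/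
theorem energyIneq_dampedCoeff (hu : StronglyMeasurable (uncurry u))
    (hv : StronglyMeasurable (uncurry v)) {M : ℝ} (hM : ∀ s y, ‖u s y‖ * ‖v s y‖ ≤ M) {x₀ : E} {ρ : ℝ}
    (hsupp : ∀ s y, y ∉ ball x₀ ρ → u s y = 0) (m k : ι) {T : ℝ} (hT : 0 < T) (ξ : E) :
    (2 * π) ^ 2 * ‖ξ‖ ^ 2 * ∫ t in Ioo 0 T, ‖dampedCoeff b u v m k t ξ‖ ^ 2 ≤
      (∫ t in Ioo 0 T, conj (dampedCoeff b u v m k t ξ) * tensorCoeff b u v m k t ξ).re := by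
  have h := mul_setIntegral_norm_sq_duhamelExp_le (a := (2 * π) ^ 2 * ‖ξ‖ ^ 2)
    (h := fun s => tensorCoeff b u v m k s ξ) (by positivity)
    (aestronglyMeasurable_tensorCoeff_left b hu hv m k ξ) hT
    (integrableOn_tensorCoeff_left b hu hv hM hsupp m k T ξ)
  simpa only [dampedCoeff] using h

/-! ### `L²` sizes of the slices of the tensor and of its heat potential -/

/-- **The slices of the tensor components are in `L¹ ∩ L²`** (complexified), with
`∫ ‖(u ⊗ v)_{mk}(s, ·)‖ₑ² ≤ M² |B(x₀, ρ)|`. [folklore] -/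
theorem memLp_two_tensorComp_slice (hu : StronglyMeasurable (uncurry u))
    (hv : StronglyMeasurable (uncurry v)) {M : ℝ} (hM : ∀ s y, ‖u s y‖ * ‖v s y‖ ≤ M) {x₀ : E} {ρ : ℝ}
    (hsupp : ∀ s y, y ∉ ball x₀ ρ → u s y = 0) (m k : ι) (s : ℝ) :
    Integrable (fun y => ((tensorComp b u v m k (s, y) : ℝ) : ℂ)) ∧
      MemLp (fun y => ((tensorComp b u v m k (s, y) : ℝ) : ℂ)) 2 ∧
      ∫⁻ y, ‖((tensorComp b u v m k (s, y) : ℝ) : ℂ)‖ₑ ^ 2 ≤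
        ENNReal.ofReal (M ^ 2 * (volume (ball x₀ ρ)).toReal) := by
  obtain ⟨hint1, -, hint2, hle2⟩ := integrable_tensorComp_slice b hu hv hM hsupp m k s
  have hM' : ∀ y, ‖((tensorComp b u v m k (s, y) : ℝ) : ℂ)‖ ≤ M := fun y => by
    rw [Complex.norm_real, Real.norm_eq_abs]
    exact (abs_tensorComp_le b u v m k (s, y)).trans (hM s y)
  refine ⟨hint1.ofReal, memLp_two_of_integrable_of_bound hint1.ofReal hM', ?_⟩
  have heq : ∀ y, ‖((tensorComp b u v m k (s, y) : ℝ) : ℂ)‖ₑ ^ 2 =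
      ENNReal.ofReal (tensorComp b u v m k (s, y) ^ 2) := fun y => by
    rw [enorm_sq_eq_ofReal_norm_sq', Complex.norm_real, Real.norm_eq_abs, sq_abs]
  calc ∫⁻ y, ‖((tensorComp b u v m k (s, y) : ℝ) : ℂ)‖ₑ ^ 2
      = ∫⁻ y, ENNReal.ofReal (tensorComp b u v m k (s, y) ^ 2) := lintegral_congr heq
    _ = ENNReal.ofReal (∫ y, tensorComp b u v m k (s, y) ^ 2) :=
        (ofReal_integral_eq_lintegral_ofReal hint2 (Eventually.of_forall fun _ => sq_nonneg _)).symm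
    _ ≤ _ := ENNReal.ofReal_le_ofReal hle2

/-- **The slices of the heat potentials are in `L¹ ∩ L²`** (complexified), with
`∫ ‖V(u ⊗ v)_{mk}(t, ·)‖ₑ² ≤ K · t M |B(x₀, ρ)|` where `K` bounds the potential pointwise
(`enorm_heatPotentialComp_le` and (20)). [folklore] -/
theorem memLp_two_heatPotentialComp_slice (hu : StronglyMeasurable (uncurry u))
    (hv : StronglyMeasurable (uncurry v)) {M : ℝ} (hM : ∀ s y, ‖u s y‖ * ‖v s y‖ ≤ M) {x₀ : E} {ρ : ℝ}
    (hsupp : ∀ s y, y ∉ ball x₀ ρ → u s y = 0) (m k : ι) {t : ℝ} (ht : 0 ≤ t) {K : ℝ≥0∞} (hK : K ≠ ∞)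
    (hWK : ∀ x, ‖heatPotentialComp b u v m k t x‖ₑ ≤ K) :
    Integrable (fun x => (heatPotentialComp b u v m k t x : ℂ)) ∧
      MemLp (fun x => (heatPotentialComp b u v m k t x : ℂ)) 2 ∧
      ∫⁻ x, ‖(heatPotentialComp b u v m k t x : ℂ)‖ₑ ^ 2 ≤
        K * ENNReal.ofReal (t * (M * (volume (ball x₀ ρ)).toReal)) := by
  obtain ⟨hWi, hWle⟩ := integrable_heatPotentialComp_slice b hu hv hM hsupp m k ht
  have hK' : ∀ x, ‖(heatPotentialComp b u v m k t x : ℂ)‖ ≤ K.toReal := fun x => by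
    rw [Complex.norm_real]
    calc ‖heatPotentialComp b u v m k t x‖ = (‖heatPotentialComp b u v m k t x‖ₑ).toReal := by simp
      _ ≤ K.toReal := ENNReal.toReal_mono hK (hWK x)
  refine ⟨hWi.ofReal, memLp_two_of_integrable_of_bound hWi.ofReal hK', ?_⟩
  calc ∫⁻ x, ‖(heatPotentialComp b u v m k t x : ℂ)‖ₑ ^ 2
      = ∫⁻ x, ‖heatPotentialComp b u v m k t x‖ₑ * ‖heatPotentialComp b u v m k t x‖ₑ := by
        refine lintegral_congr fun x => ?_
        rw [sq, enorm_eq_nnnorm, enorm_eq_nnnorm, Complex.nnnorm_real]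
    _ ≤ ∫⁻ x, K * ‖heatPotentialComp b u v m k t x‖ₑ := lintegral_mono fun x => by gcongr; exact hWK x
    _ = K * ∫⁻ x, ‖heatPotentialComp b u v m k t x‖ₑ := lintegral_const_mul' _ _ hK
    _ ≤ _ := by gcongr

/-! ### Joint integrability of `conj(Y) (u ⊗ v)^` on `(0, T) × E` and Parseval per slice -/

/-- **Joint integrability on `(0, T) × E_ξ`** of `(t, ξ) ↦ conj(Y_{mk}(t, ξ)) (u ⊗ v)^_{mk}(t, ξ)`
for a nice tensor whose heat potentials are bounded by `K < ∞` (Cauchy–Schwarz in `ξ` and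
Plancherel twice: `‖Y(t,·)‖₂ ‖(u ⊗ v)^(t,·)‖₂ = ‖V(u ⊗ v)(t)‖₂ ‖(u ⊗ v)(t)‖₂ ≤ (K T M |B|)^{1/2} (M²|B|)^{1/2}`).
[folklore] -/
theorem integrable_conj_dampedCoeff_mul_tensorCoeff (hu : StronglyMeasurable (uncurry u))
    (hv : StronglyMeasurable (uncurry v)) {M : ℝ} (hM : ∀ s y, ‖u s y‖ * ‖v s y‖ ≤ M) {x₀ : E} {ρ : ℝ}
    (hsupp : ∀ s y, y ∉ ball x₀ ρ → u s y = 0) (m k : ι) (T : ℝ) {K : ℝ≥0∞} (hK : K ≠ ∞)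
    (hWK : ∀ t, 0 < t → ∀ x, ‖heatPotentialComp b u v m k t x‖ₑ ≤ K) :
    Integrable (fun q : ℝ × E => conj (dampedCoeff b u v m k q.1 q.2) * tensorCoeff b u v m k q.1 q.2)
      (((volume : Measure ℝ).restrict (Ioo 0 T)).prod (volume : Measure E)) := by
  set ν : Measure (ℝ × E) := ((volume : Measure ℝ).restrict (Ioo 0 T)).prod (volume : Measure E) with hν
  have hYm := stronglyMeasurable_dampedCoeff b hu hv m k
  have hΓm := stronglyMeasurable_tensorCoeff b hu hv m k
  have hmeas : AEStronglyMeasurable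
      (fun q : ℝ × E => conj (dampedCoeff b u v m k q.1 q.2) * tensorCoeff b u v m k q.1 q.2) ν :=
    ((Complex.continuous_conj.comp_stronglyMeasurable hYm).mul hΓm).aestronglyMeasurable
  refine ⟨hmeas, ?_⟩
  rw [hasFiniteIntegral_iff_enorm]
  -- the bound per slice
  set Λ : ℝ≥0∞ := (K * ENNReal.ofReal (T * (M * (volume (ball x₀ ρ)).toReal))) ^ (1 / 2 : ℝ) *
    (ENNReal.ofReal (M ^ 2 * (volume (ball x₀ ρ)).toReal)) ^ (1 / 2 : ℝ) with hΛ
  have hΛtop : Λ ≠ ∞ := by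
    refine ENNReal.mul_ne_top ?_ ?_
    · exact ENNReal.rpow_ne_top_of_nonneg (by norm_num) (ENNReal.mul_ne_top hK ENNReal.ofReal_ne_top)
    · exact ENNReal.rpow_ne_top_of_nonneg (by norm_num) ENNReal.ofReal_ne_top
  have hslice : ∀ t ∈ Ioo (0 : ℝ) T,
      ∫⁻ ξ, ‖conj (dampedCoeff b u v m k t ξ) * tensorCoeff b u v m k t ξ‖ₑ ≤ Λ := by
    intro t ht
    obtain ⟨hg1, hg2, hgle⟩ := memLp_two_tensorComp_slice b hu hv hM hsupp m k t
    obtain ⟨hW1, hW2, hWle⟩ := memLp_two_heatPotentialComp_slice b hu hv hM hsupp m k ht.1.le hK (hWK t ht.1)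
    -- Plancherel twice
    have hPΓ : ∫⁻ ξ, ‖tensorCoeff b u v m k t ξ‖ₑ ^ 2 ≤ ENNReal.ofReal (M ^ 2 * (volume (ball x₀ ρ)).toReal) := by
      have h := FunctionSpaces.lintegral_enorm_sq_fourierIntegral_eq hg1 hg2
      exact (le_of_eq h).trans hgle
    have hPY : ∫⁻ ξ, ‖dampedCoeff b u v m k t ξ‖ₑ ^ 2 ≤ K * ENNReal.ofReal (T * (M * (volume (ball x₀ ρ)).toReal)) := by
      have h := FunctionSpaces.lintegral_enorm_sq_fourierIntegral_eq hW1 hW2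
      have hF : 𝓕 (fun x => (heatPotentialComp b u v m k t x : ℂ)) = fun ξ => dampedCoeff b u v m k t ξ :=
        funext fun ξ => fourier_heatPotentialComp b hu hv hM hsupp m k ht.1.le ξ
      rw [hF] at h
      refine (le_of_eq h).trans (hWle.trans ?_)
      have hM0 : 0 ≤ M := (mul_nonneg (norm_nonneg _) (norm_nonneg _)).trans (hM t x₀)
      have hMv : 0 ≤ M * (volume (ball x₀ ρ)).toReal := mul_nonneg hM0 ENNReal.toReal_nonneg
      exact mul_le_mul' le_rfl (ENNReal.ofReal_le_ofReal (mul_le_mul_of_nonneg_right ht.2.le hMv))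
    -- Cauchy–Schwarz in `ξ`
    have hYa : AEMeasurable (fun ξ => ‖dampedCoeff b u v m k t ξ‖ₑ) (volume : Measure E) :=
      (hYm.measurable.comp (measurable_const.prodMk measurable_id)).enorm.aemeasurable
    have hΓa : AEMeasurable (fun ξ => ‖tensorCoeff b u v m k t ξ‖ₑ) (volume : Measure E) :=
      (hΓm.measurable.comp (measurable_const.prodMk measurable_id)).enorm.aemeasurable
    have hCS := ENNReal.lintegral_mul_le_Lp_mul_Lq (volume : Measure E) Real.HolderConjugate.two_two hYa hΓa
    simp only [ENNReal.rpow_two] at hCS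
    calc ∫⁻ ξ, ‖conj (dampedCoeff b u v m k t ξ) * tensorCoeff b u v m k t ξ‖ₑ
        = ∫⁻ ξ, ‖dampedCoeff b u v m k t ξ‖ₑ * ‖tensorCoeff b u v m k t ξ‖ₑ := by
          refine lintegral_congr fun ξ => ?_
          rw [enorm_mul, enorm_eq_nnnorm, RCLike.nnnorm_conj, ← enorm_eq_nnnorm]
      _ ≤ (∫⁻ ξ, ‖dampedCoeff b u v m k t ξ‖ₑ ^ 2) ^ (1 / 2 : ℝ) *
            (∫⁻ ξ, ‖tensorCoeff b u v m k t ξ‖ₑ ^ 2) ^ (1 / 2 : ℝ) := hCS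
      _ ≤ Λ := by rw [hΛ]; gcongr
  calc ∫⁻ q, ‖conj (dampedCoeff b u v m k q.1 q.2) * tensorCoeff b u v m k q.1 q.2‖ₑ ∂ν
      = ∫⁻ t in Ioo 0 T, ∫⁻ ξ, ‖conj (dampedCoeff b u v m k t ξ) * tensorCoeff b u v m k t ξ‖ₑ := by
        rw [hν, lintegral_prod _ hmeas.enorm]
    _ ≤ ∫⁻ t in Ioo 0 T, Λ := setLIntegral_mono' measurableSet_Ioo hslice
    _ = Λ * volume (Ioo (0 : ℝ) T) := setLIntegral_const _ _
    _ < ∞ := ENNReal.mul_lt_top hΛtop.lt_top measure_Ioo_lt_top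

/-- **Parseval per slice** (Koch–Tataru 2001, Remark 3.3: the step
`∫ conj(𝓕Vg) 𝓕g dξ = ∫ (Vg) g dx`): for a nice tensor with bounded heat potentials and `t > 0`,
`Re ∫ conj(Y_{mk}(t, ξ)) (u ⊗ v)^_{mk}(t, ξ) dξ = ∫ V(u ⊗ v)_{mk}(t, x) (u ⊗ v)_{mk}(t, x) dx`.
[cite: KochTataruAdvMath2001, Remark 3.3 (21)] -/
theorem re_integral_conj_dampedCoeff_mul_tensorCoeff (hu : StronglyMeasurable (uncurry u))
    (hv : StronglyMeasurable (uncurry v)) {M : ℝ} (hM : ∀ s y, ‖u s y‖ * ‖v s y‖ ≤ M) {x₀ : E} {ρ : ℝ}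
    (hsupp : ∀ s y, y ∉ ball x₀ ρ → u s y = 0) (m k : ι) {t : ℝ} (ht : 0 < t) {K : ℝ≥0∞} (hK : K ≠ ∞)
    (hWK : ∀ x, ‖heatPotentialComp b u v m k t x‖ₑ ≤ K) :
    (∫ ξ, conj (dampedCoeff b u v m k t ξ) * tensorCoeff b u v m k t ξ).re =
      ∫ x, heatPotentialComp b u v m k t x * tensorComp b u v m k (t, x) := by
  obtain ⟨hg1, hg2, -⟩ := memLp_two_tensorComp_slice b hu hv hM hsupp m k t
  obtain ⟨hW1, hW2, -⟩ := memLp_two_heatPotentialComp_slice b hu hv hM hsupp m k ht.le hK hWK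
  have h := re_integral_conj_fourier_mul_eq hW1 hW2 hg1 hg2
  have hF : 𝓕 (fun x => (heatPotentialComp b u v m k t x : ℂ)) = fun ξ => dampedCoeff b u v m k t ξ :=
    funext fun ξ => fourier_heatPotentialComp b hu hv hM hsupp m k ht.le ξ
  have hG : ∀ ξ, 𝓕 (fun y => ((tensorComp b u v m k (t, y) : ℝ) : ℂ)) ξ = tensorCoeff b u v m k t ξ :=
    fun ξ => rfl
  rw [hF] at h
  simp only [hG] at h
  have hfun : (fun x => conj ((heatPotentialComp b u v m k t x : ℝ) : ℂ) *
      ((tensorComp b u v m k (t, x) : ℝ) : ℂ)) =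
      fun x => ((heatPotentialComp b u v m k t x * tensorComp b u v m k (t, x) : ℝ) : ℂ) := by
    funext x
    rw [Complex.conj_ofReal, ← Complex.ofReal_mul]
  rw [h, hfun, integral_complex_ofReal, Complex.ofReal_re]

/-! ### The near-field estimate for nice data -/

/-- **Step 1–2 of the assembly: `∫₀ᵀ ‖B(u,v)(t)‖²_{L²} dt ≤ ∑ₘ ∑ₖ ∫ Re ∫₀ᵀ conj(Y_{mk}) (u ⊗ v)^_{mk} dt dξ`**
(Plancherel per slice, Tonelli in `(t, ξ)`, the energy inequality mode by mode; all in `ℝ≥0∞`).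
[cite: KochTataruAdvMath2001, Lemma 3.2 Steps 3–4 (15)–(17)] -/
theorem lintegral_lintegral_enorm_sq_kochTataruBilinear_le_sum (hu : StronglyMeasurable (uncurry u))
    (hv : StronglyMeasurable (uncurry v)) {M : ℝ} (hM : ∀ s y, ‖u s y‖ * ‖v s y‖ ≤ M) {x₀ : E} {ρ : ℝ}
    (hsupp : ∀ s y, y ∉ ball x₀ ρ → u s y = 0) (huX : eKochTataruNorm u < ∞) (hvX : eKochTataruNorm v < ∞)
    {T : ℝ} (hT : 0 < T) :
    ∫⁻ t in Ioo 0 T, ∫⁻ x, ‖kochTataruBilinear u v t x‖ₑ ^ 2 ≤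
      ∑ m, ∑ k, ∫⁻ ξ, ENNReal.ofReal
        ((∫ t in Ioo 0 T, conj (dampedCoeff b u v m k t ξ) * tensorCoeff b u v m k t ξ).re) := by
  have hYm := fun m k => stronglyMeasurable_dampedCoeff b hu hv m k
  -- the majorant `F(t, ξ) = ∑∑ ofReal((2π)²|ξ|² |Y_{mk}(t,ξ)|²)`
  set a : E → ℝ := fun ξ => (2 * π) ^ 2 * ‖ξ‖ ^ 2 with ha
  have ha0 : ∀ ξ, 0 ≤ a ξ := fun ξ => by positivity
  set G : ι → ι → ℝ × E → ℝ≥0∞ := fun m k q => ENNReal.ofReal (a q.2 * ‖dampedCoeff b u v m k q.1 q.2‖ ^ 2)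
    with hG
  have hGm : ∀ m k, Measurable (G m k) := by
    intro m k
    refine ENNReal.measurable_ofReal.comp (Measurable.mul ?_ ?_)
    · exact (continuous_const.mul (continuous_norm.comp continuous_snd |>.pow 2)).measurable
    · exact (hYm m k).measurable.norm.pow_const 2
  -- Step 1: per slice
  have hstep1 : ∫⁻ t in Ioo 0 T, ∫⁻ x, ‖kochTataruBilinear u v t x‖ₑ ^ 2 ≤
      ∫⁻ t in Ioo 0 T, ∫⁻ ξ, ∑ m, ∑ k, G m k (t, ξ) := by
    refine setLIntegral_mono' measurableSet_Ioo fun t ht => ?_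
    refine (lintegral_enorm_sq_kochTataruBilinear_slice_le b hu hv hM hsupp huX hvX ht.1).trans
      (lintegral_mono fun ξ => le_of_eq ?_)
    rw [hG]
    simp only
    rw [Finset.mul_sum, ENNReal.ofReal_sum_of_nonneg (fun m _ => mul_nonneg (ha0 ξ)
      (Finset.sum_nonneg fun k _ => sq_nonneg _))]
    refine Finset.sum_congr rfl fun m _ => ?_
    rw [Finset.mul_sum, ENNReal.ofReal_sum_of_nonneg (fun k _ => mul_nonneg (ha0 ξ) (sq_nonneg _))]
  -- Step 2: Tonelli and the sums
  have hstep2 : ∫⁻ t in Ioo 0 T, ∫⁻ ξ, ∑ m, ∑ k, G m k (t, ξ) =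
      ∑ m, ∑ k, ∫⁻ ξ, ∫⁻ t in Ioo 0 T, G m k (t, ξ) := by
    have hsum : Measurable fun q : ℝ × E => ∑ m, ∑ k, G m k q :=
      Finset.measurable_sum _ fun m _ => Finset.measurable_sum _ fun k _ => hGm m k
    have hGt : ∀ m k (ξ : E), Measurable fun t : ℝ => G m k (t, ξ) := fun m k ξ =>
      (hGm m k).comp (measurable_id.prodMk measurable_const)
    rw [lintegral_lintegral_swap hsum.aemeasurable]
    have hinner : ∀ ξ : E, ∫⁻ t in Ioo 0 T, ∑ m, ∑ k, G m k (t, ξ) =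
        ∑ m, ∑ k, ∫⁻ t in Ioo 0 T, G m k (t, ξ) := by
      intro ξ
      rw [lintegral_finsetSum _ fun m _ => Finset.measurable_sum _ fun k _ => hGt m k ξ]
      exact Finset.sum_congr rfl fun m _ => lintegral_finsetSum _ fun k _ => hGt m k ξ
    rw [lintegral_congr hinner,
      lintegral_finsetSum _ fun m _ => Finset.measurable_sum _ fun k _ => (hGm m k).lintegral_prod_left']
    exact Finset.sum_congr rfl fun m _ =>
      lintegral_finsetSum _ fun k _ => (hGm m k).lintegral_prod_left'
  -- Step 3: the energy inequality, mode by mode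
  have hstep3 : ∀ m k (ξ : E), ∫⁻ t in Ioo 0 T, G m k (t, ξ) ≤ ENNReal.ofReal
      ((∫ t in Ioo 0 T, conj (dampedCoeff b u v m k t ξ) * tensorCoeff b u v m k t ξ).re) := by
    intro m k ξ
    have hYi : IntegrableOn (fun t : ℝ => ‖dampedCoeff b u v m k t ξ‖ ^ 2) (Ioo 0 T) := by
      refine Measure.integrableOn_of_bounded (M := (T * (M * (volume (ball x₀ ρ)).toReal)) ^ 2)
        measure_Ioo_lt_top.ne ?_ ?_
      · exact (((hYm m k).measurable.comp (measurable_id.prodMk measurable_const)).norm.pow_const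
          2).aestronglyMeasurable
      · refine (ae_restrict_iff' measurableSet_Ioo).2 (Eventually.of_forall fun t ht => ?_)
        rw [Real.norm_of_nonneg (sq_nonneg _)]
        have h1 := norm_dampedCoeff_le b hu hv hM hsupp m k ht.1.le ξ
        have hM0 : 0 ≤ M := (mul_nonneg (norm_nonneg _) (norm_nonneg _)).trans (hM t x₀)
        have h2 : t * (M * (volume (ball x₀ ρ)).toReal) ≤ T * (M * (volume (ball x₀ ρ)).toReal) :=
          mul_le_mul_of_nonneg_right ht.2.le (mul_nonneg hM0 ENNReal.toReal_nonneg)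
        exact pow_le_pow_left₀ (norm_nonneg _) (h1.trans h2) 2
    calc ∫⁻ t in Ioo 0 T, G m k (t, ξ)
        = ∫⁻ t in Ioo 0 T, ENNReal.ofReal (a ξ) * ENNReal.ofReal (‖dampedCoeff b u v m k t ξ‖ ^ 2) := by
          refine lintegral_congr fun t => ?_
          rw [hG]
          simp only
          rw [ENNReal.ofReal_mul (ha0 ξ)]
      _ = ENNReal.ofReal (a ξ) * ENNReal.ofReal (∫ t in Ioo 0 T, ‖dampedCoeff b u v m k t ξ‖ ^ 2) := by
          rw [lintegral_const_mul' _ _ ENNReal.ofReal_ne_top,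
            ofReal_integral_eq_lintegral_ofReal hYi (Eventually.of_forall fun _ => sq_nonneg _)]
      _ = ENNReal.ofReal (a ξ * ∫ t in Ioo 0 T, ‖dampedCoeff b u v m k t ξ‖ ^ 2) :=
          (ENNReal.ofReal_mul (ha0 ξ)).symm
      _ ≤ _ := ENNReal.ofReal_le_ofReal (energyIneq_dampedCoeff b hu hv hM hsupp m k hT ξ)
  -- assemble
  refine hstep1.trans ?_
  rw [hstep2]
  exact Finset.sum_le_sum fun m _ => Finset.sum_le_sum fun k _ => lintegral_mono (hstep3 m k)

/-- **Step 4 of the assembly** (Fubini in `(t, ξ)`, Parseval per slice, `|∫ Vg · g| ≤ ‖Vg‖_∞ ‖g‖₁`):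
for a nice tensor whose heat potentials are bounded by `K < ∞`,
`∫ Re ∫₀ᵀ conj(Y_{mk}) (u ⊗ v)^_{mk} dt dξ ≤ K ∫_{(0,T) × E} |(u ⊗ v)_{mk}|` (in `ℝ≥0∞`). [cite: KochTataruAdvMath2001, Remark 3.3 (21)] -/
theorem lintegral_ofReal_re_setIntegral_le (hu : StronglyMeasurable (uncurry u))
    (hv : StronglyMeasurable (uncurry v)) {M : ℝ} (hM : ∀ s y, ‖u s y‖ * ‖v s y‖ ≤ M) {x₀ : E} {ρ : ℝ}
    (hsupp : ∀ s y, y ∉ ball x₀ ρ → u s y = 0) (m k : ι) {T : ℝ} (hT : 0 < T) {K : ℝ≥0∞} (hK : K ≠ ∞)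
    (hWK : ∀ t, 0 < t → ∀ x, ‖heatPotentialComp b u v m k t x‖ₑ ≤ K) :
    ∫⁻ ξ, ENNReal.ofReal ((∫ t in Ioo 0 T, conj (dampedCoeff b u v m k t ξ) * tensorCoeff b u v m k t ξ).re) ≤
      K * ∫⁻ p in Ioo 0 T ×ˢ univ, ‖tensorComp b u v m k p‖ₑ ∂(volume : Measure (ℝ × E)) := by
  set μ : Measure ℝ := (volume : Measure ℝ).restrict (Ioo 0 T) with hμ
  set Φ : ℝ × E → ℂ := fun q => conj (dampedCoeff b u v m k q.1 q.2) * tensorCoeff b u v m k q.1 q.2 with hΦ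
  have hΦi : Integrable Φ (μ.prod (volume : Measure E)) :=
    integrable_conj_dampedCoeff_mul_tensorCoeff b hu hv hM hsupp m k T hK hWK
  obtain ⟨hgi, -⟩ := integrable_tensorComp_slab b hu hv hM hsupp m k hT.le
  have hgi' : Integrable (tensorComp b u v m k) (μ.prod (volume : Measure E)) := by
    rwa [hμ, ← FluidPDE.volume_restrict_prod_univ_eq_prod]
  -- the `ξ`-function and its real part
  set F : E → ℂ := fun ξ => ∫ t, Φ (t, ξ) ∂μ with hF
  have hFi : Integrable F := hΦi.integral_prod_right
  have hFre_nonneg : ∀ ξ, 0 ≤ (F ξ).re := fun ξ =>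
    le_trans (mul_nonneg (by positivity) (integral_nonneg fun _ => sq_nonneg _))
      (energyIneq_dampedCoeff b hu hv hM hsupp m k hT ξ)
  -- the real number bounding everything
  set J : ℝ := ∫ p, |tensorComp b u v m k p| ∂(μ.prod (volume : Measure E)) with hJ
  have hkey : ∫ ξ, (F ξ).re ≤ K.toReal * J := by
    -- swap the integrals and take real parts inside
    have h1 : ∫ ξ, (F ξ).re = (∫ ξ, F ξ).re := by
      have := integral_re hFi
      simpa only [RCLike.re_to_complex] using this
    have h2 : ∫ ξ, F ξ = ∫ t, (∫ ξ, Φ (t, ξ)) ∂μ := by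
      rw [hF]
      exact (integral_integral_swap (f := fun t ξ => Φ (t, ξ)) hΦi).symm
    have hti : Integrable (fun t => ∫ ξ, Φ (t, ξ)) μ := hΦi.integral_prod_left
    have h3 : (∫ t, (∫ ξ, Φ (t, ξ)) ∂μ).re = ∫ t, (∫ ξ, Φ (t, ξ)).re ∂μ := by
      have := integral_re hti
      simpa only [RCLike.re_to_complex] using this.symm
    -- per slice: Parseval and `|∫ W g| ≤ K ∫ |g|`
    have hgn : Integrable (fun t => ∫ y, ‖tensorComp b u v m k (t, y)‖) μ := hgi'.integral_norm_prod_left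
    have h4 : ∫ t, (∫ ξ, Φ (t, ξ)).re ∂μ ≤ ∫ t, K.toReal * (∫ y, ‖tensorComp b u v m k (t, y)‖) ∂μ := by
      refine integral_mono_ae hti.re (hgn.const_mul _) ?_
      rw [hμ, EventuallyLE, ae_restrict_iff' measurableSet_Ioo]
      refine Eventually.of_forall fun t ht => ?_
      rw [hΦ]
      simp only
      rw [re_integral_conj_dampedCoeff_mul_tensorCoeff b hu hv hM hsupp m k ht.1 hK (hWK t ht.1)]
      obtain ⟨hgr, -, -, -⟩ := integrable_tensorComp_slice b hu hv hM hsupp m k t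
      have hbound : ∀ x, ‖heatPotentialComp b u v m k t x * tensorComp b u v m k (t, x)‖ ≤
          K.toReal * ‖tensorComp b u v m k (t, x)‖ := fun x => by
        rw [norm_mul]
        refine mul_le_mul_of_nonneg_right ?_ (norm_nonneg _)
        calc ‖heatPotentialComp b u v m k t x‖ = (‖heatPotentialComp b u v m k t x‖ₑ).toReal := by simp
          _ ≤ K.toReal := ENNReal.toReal_mono hK (hWK t ht.1 x)
      calc ∫ x, heatPotentialComp b u v m k t x * tensorComp b u v m k (t, x)
          ≤ ‖∫ x, heatPotentialComp b u v m k t x * tensorComp b u v m k (t, x)‖ := Real.le_norm_self _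
        _ ≤ ∫ x, K.toReal * ‖tensorComp b u v m k (t, x)‖ :=
            norm_integral_le_of_norm_le (hgr.norm.const_mul _) (Eventually.of_forall hbound)
        _ = K.toReal * ∫ y, ‖tensorComp b u v m k (t, y)‖ := integral_const_mul _ _
    have h5 : ∫ t, K.toReal * (∫ y, ‖tensorComp b u v m k (t, y)‖) ∂μ = K.toReal * J := by
      rw [integral_const_mul, hJ, integral_prod _ hgi'.abs]
      rfl
    rw [h1, h2, h3]
    exact h4.trans (le_of_eq h5)
  -- back to `ℝ≥0∞`
  have hJ' : ENNReal.ofReal J = ∫⁻ p in Ioo 0 T ×ˢ univ, ‖tensorComp b u v m k p‖ₑ ∂(volume : Measure (ℝ × E)) := by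
    rw [hJ, ofReal_integral_eq_lintegral_ofReal hgi'.abs (Eventually.of_forall fun _ => abs_nonneg _),
      FluidPDE.volume_restrict_prod_univ_eq_prod, ← hμ]
    exact lintegral_congr fun p => by rw [← Real.enorm_abs, Real.enorm_eq_ofReal (abs_nonneg _)]
  calc ∫⁻ ξ, ENNReal.ofReal ((∫ t in Ioo 0 T, conj (dampedCoeff b u v m k t ξ) * tensorCoeff b u v m k t ξ).re)
      = ∫⁻ ξ, ENNReal.ofReal ((F ξ).re) := rfl
    _ = ENNReal.ofReal (∫ ξ, (F ξ).re) :=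
        (ofReal_integral_eq_lintegral_ofReal hFi.re (Eventually.of_forall hFre_nonneg)).symm
    _ ≤ ENNReal.ofReal (K.toReal * J) := ENNReal.ofReal_le_ofReal hkey
    _ = K * ENNReal.ofReal J := by rw [ENNReal.ofReal_mul ENNReal.toReal_nonneg, ENNReal.ofReal_toReal hK]
    _ = _ := by rw [hJ']

end Objects

/-! ## The near-field `L²` estimate for nice data -/

section NiceData

variable {E : Type*} [NormedAddCommGroup E] [InnerProductSpace ℝ E] [FiniteDimensional ℝ E]
  [MeasurableSpace E] [BorelSpace E]

/-- The tensor majorant `‖u‖ ‖v‖` on the slab `(0, T) × E` of a field `u` supported in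
`ℝ × B(x₀, ρ)` with `T ≤ ρ²` is controlled by the Carleson box `Q(x₀, ρ)`:
`∫_{(0,T) × E} ‖u‖ ‖v‖ ≤ ρ^d ‖u‖_X ‖v‖_X` (Koch–Tataru 2001, Lemma 3.1 on the doubled box).
[cite: KochTataruAdvMath2001, Lemma 3.1] -/
theorem setLIntegral_slab_mul_le_of_support {u v : ℝ → E → E}
    (hu : AEStronglyMeasurable (uncurry u) ((volume : Measure (ℝ × E)).restrict (Ioi 0 ×ˢ univ)))
    (hv : AEStronglyMeasurable (uncurry v) ((volume : Measure (ℝ × E)).restrict (Ioi 0 ×ˢ univ)))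
    {x₀ : E} {ρ : ℝ} (hρ : 0 < ρ) (hsupp : ∀ s y, y ∉ ball x₀ ρ → u s y = 0) {T : ℝ} (hTρ : T ≤ ρ ^ 2) :
    ∫⁻ p in Ioo 0 T ×ˢ univ, ‖u p.1 p.2‖ₑ * ‖v p.1 p.2‖ₑ ∂(volume : Measure (ℝ × E)) ≤
      ENNReal.ofReal (ρ ^ Module.finrank ℝ E) * eKochTataruNorm u * eKochTataruNorm v := by
  have hind : ∀ p : ℝ × E, ‖u p.1 p.2‖ₑ * ‖v p.1 p.2‖ₑ =
      ((univ : Set ℝ) ×ˢ ball x₀ ρ).indicator (fun q : ℝ × E => ‖u q.1 q.2‖ₑ * ‖v q.1 q.2‖ₑ) p := by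
    intro p
    by_cases hp : p.2 ∈ ball x₀ ρ
    · rw [indicator_of_mem (show p ∈ (univ : Set ℝ) ×ˢ ball x₀ ρ from ⟨mem_univ _, hp⟩)]
    · rw [indicator_of_notMem (show p ∉ (univ : Set ℝ) ×ˢ ball x₀ ρ from fun h => hp h.2),
        hsupp p.1 p.2 hp, enorm_zero, zero_mul]
  calc ∫⁻ p in Ioo 0 T ×ˢ univ, ‖u p.1 p.2‖ₑ * ‖v p.1 p.2‖ₑ ∂(volume : Measure (ℝ × E))
      = ∫⁻ p in Ioo 0 T ×ˢ univ, ((univ : Set ℝ) ×ˢ ball x₀ ρ).indicator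
          (fun q : ℝ × E => ‖u q.1 q.2‖ₑ * ‖v q.1 q.2‖ₑ) p ∂(volume : Measure (ℝ × E)) :=
        lintegral_congr hind
    _ = ∫⁻ p in Ioo 0 T ×ˢ ball x₀ ρ, ‖u p.1 p.2‖ₑ * ‖v p.1 p.2‖ₑ ∂(volume : Measure (ℝ × E)) := by
        rw [lintegral_indicator (MeasurableSet.univ.prod measurableSet_ball), Measure.restrict_restrict
          (MeasurableSet.univ.prod measurableSet_ball), prod_inter_prod, univ_inter, inter_univ]
    _ ≤ ∫⁻ p in Ioo 0 (ρ ^ 2) ×ˢ ball x₀ ρ, ‖u p.1 p.2‖ₑ * ‖v p.1 p.2‖ₑ ∂(volume : Measure (ℝ × E)) :=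
        lintegral_mono_set (prod_mono (Ioo_subset_Ioo le_rfl hTρ) subset_rfl)
    _ ≤ _ := setLIntegral_box_mul_le hu hv x₀ hρ

/-- **The near-field `L²` estimate for nice data** (Koch–Tataru 2001, Lemma 3.2, (13) through (15):
`∫₀¹ ∫ |∇Vf|² ≤ ‖f‖_Y ‖f‖_{L¹}`, Steps 3–5 / Remark 3.3, for the explicit operator): there is
`C = C(E)` such that for all **nice** pairs — `u`, `v` jointly strongly measurable with finite
Koch–Tataru norms, `‖u‖ ‖v‖` bounded, `u` supported in `ℝ × B(x₀, ρ)` — and `0 < T ≤ ρ²`,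
`∫₀ᵀ ∫_E ‖B(u, v)(t, x)‖² dx dt ≤ C ρ^d ‖u‖_X² ‖v‖_X²`. Proof: Plancherel per slice and the symbol bound
(`lintegral_enorm_sq_kochTataruBilinear_slice_le`), Tonelli, the energy inequality mode by mode
(`energyIneq_dampedCoeff`), Fubini and Parseval back (`lintegral_ofReal_re_setIntegral_le`), the
heat-potential bound (20) (`exists_setLIntegral_heatKernel_mul_le`) and Lemma 3.1 on the doubled box
(`setLIntegral_slab_mul_le_of_support`); the constant is `(d² + 1) C₍₂₀₎`. The boundedness and
support assumptions only serve the absolute convergence of the Fourier-side integrals; they are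
removed in the next step by truncation. [cite: KochTataruAdvMath2001, Lemma 3.2 (13), (15) and Remark 3.3] -/
theorem exists_lintegral_sq_kochTataruBilinear_le_of_nice :
    ∃ C : ℝ, 0 < C ∧ ∀ {u v : ℝ → E → E}, StronglyMeasurable (uncurry u) → StronglyMeasurable (uncurry v) →
      ∀ {M : ℝ}, (∀ s y, ‖u s y‖ * ‖v s y‖ ≤ M) → ∀ {x₀ : E} {ρ : ℝ}, 0 < ρ →
      (∀ s y, y ∉ ball x₀ ρ → u s y = 0) → eKochTataruNorm u < ∞ → eKochTataruNorm v < ∞ →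
      ∀ {T : ℝ}, 0 < T → T ≤ ρ ^ 2 →
        ∫⁻ t in Ioo 0 T, ∫⁻ x, ‖kochTataruBilinear u v t x‖ₑ ^ 2 ≤
          ENNReal.ofReal (C * ρ ^ Module.finrank ℝ E) * eKochTataruNorm u ^ 2 * eKochTataruNorm v ^ 2 := by
  obtain ⟨C₀, hC₀, h20⟩ := exists_setLIntegral_heatKernel_mul_le (E := E)
  set d : ℕ := Module.finrank ℝ E with hd
  refine ⟨((d : ℝ) ^ 2 + 1) * C₀, by positivity, ?_⟩
  intro u v hu hv M hM x₀ ρ hρ hsupp huX hvX T hT hTρ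
  set b : OrthonormalBasis (Fin d) ℝ E := stdOrthonormalBasis ℝ E with hb
  have hu' : AEStronglyMeasurable (uncurry u) ((volume : Measure (ℝ × E)).restrict (Ioi 0 ×ˢ univ)) :=
    hu.aestronglyMeasurable
  have hv' : AEStronglyMeasurable (uncurry v) ((volume : Measure (ℝ × E)).restrict (Ioi 0 ×ˢ univ)) :=
    hv.aestronglyMeasurable
  set nu := eKochTataruNorm u with hnu
  set nv := eKochTataruNorm v with hnv
  set K : ℝ≥0∞ := ENNReal.ofReal C₀ * nu * nv with hK
  have hKtop : K ≠ ∞ := ENNReal.mul_ne_top (ENNReal.mul_ne_top ENNReal.ofReal_ne_top huX.ne) hvX.ne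
  have hWK : ∀ (m k : Fin d) (t : ℝ), 0 < t → ∀ x, ‖heatPotentialComp b u v m k t x‖ₑ ≤ K :=
    fun m k t ht x => (enorm_heatPotentialComp_le b u v m k t x).trans (h20 hu' hv' ht x)
  have h123 := lintegral_lintegral_enorm_sq_kochTataruBilinear_le_sum b hu hv hM hsupp huX hvX hT
  have h4 : ∀ m k : Fin d, ∫⁻ ξ, ENNReal.ofReal ((∫ t in Ioo 0 T, conj (dampedCoeff b u v m k t ξ) *
      tensorCoeff b u v m k t ξ).re) ≤ K * ∫⁻ p in Ioo 0 T ×ˢ univ, ‖tensorComp b u v m k p‖ₑ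
        ∂(volume : Measure (ℝ × E)) := fun m k =>
    lintegral_ofReal_re_setIntegral_le b hu hv hM hsupp m k hT hKtop (hWK m k)
  have hg : ∀ m k : Fin d, ∫⁻ p in Ioo 0 T ×ˢ univ, ‖tensorComp b u v m k p‖ₑ ∂(volume : Measure (ℝ × E)) ≤
      ∫⁻ p in Ioo 0 T ×ˢ univ, ‖u p.1 p.2‖ₑ * ‖v p.1 p.2‖ₑ ∂(volume : Measure (ℝ × E)) := by
    intro m k
    refine lintegral_mono fun p => ?_
    rw [← ofReal_norm, ← ofReal_norm, ← ofReal_norm, ← ENNReal.ofReal_mul (norm_nonneg _), Real.norm_eq_abs]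
    exact ENNReal.ofReal_le_ofReal (abs_tensorComp_le b u v m k p)
  have hbox := setLIntegral_slab_mul_le_of_support hu' hv' hρ hsupp hTρ (v := v)
  -- assemble
  have hcard : (Finset.univ : Finset (Fin d)).card = d := by simp
  calc ∫⁻ t in Ioo 0 T, ∫⁻ x, ‖kochTataruBilinear u v t x‖ₑ ^ 2
      ≤ ∑ m : Fin d, ∑ k : Fin d, K * (ENNReal.ofReal (ρ ^ d) * nu * nv) := by
        refine h123.trans (Finset.sum_le_sum fun m _ => Finset.sum_le_sum fun k _ => ?_)
        exact (h4 m k).trans (mul_le_mul' le_rfl ((hg m k).trans hbox))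
    _ = (d : ℝ≥0∞) * ((d : ℝ≥0∞) * (K * (ENNReal.ofReal (ρ ^ d) * nu * nv))) := by
        rw [Finset.sum_const, Finset.sum_const, hcard, nsmul_eq_mul, nsmul_eq_mul]
    _ = ENNReal.ofReal ((d : ℝ) ^ 2 * C₀ * ρ ^ d) * nu ^ 2 * nv ^ 2 := by
        rw [hK, show ((d : ℝ) ^ 2 * C₀ * ρ ^ d) = (d : ℝ) ^ 2 * (C₀ * ρ ^ d) by ring,
          ENNReal.ofReal_mul (by positivity), ENNReal.ofReal_mul hC₀.le, ENNReal.ofReal_pow (Nat.cast_nonneg _),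
          ENNReal.ofReal_natCast]
        ring
    _ ≤ ENNReal.ofReal (((d : ℝ) ^ 2 + 1) * C₀ * ρ ^ d) * nu ^ 2 * nv ^ 2 := by
        gcongr
        nlinarith [hC₀, pow_nonneg hρ.le d]

end NiceData

end Literature.Analysis.FluidPDE
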